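import Summits.HubbardSuperconductivity.HubbardSuperconductivity.Theses.ThermalWedge
import Summits.HubbardSuperconductivity.HubbardSuperconductivity.Theorems.NoGoNogoThesis
import Literature.MathematicalPhysics.QuantumLattice.PairChirality
import Literature.MathematicalPhysics.QuantumLattice.SectorSpectrum
import Literature.MathematicalPhysics.QuantumLattice.LatticeToriLROProofs
import Summits.HubbardSuperconductivity.HubbardSuperconductivity.Theorems.TwTipContinuation.Negative.SeedContinuity

/-!
# Disproof of `TwTipContinuation` (stmt-HubbardSuperconductivity-1700) — standing-adversary work file, gen 3 (v2.1)

Crux (route `ThermalWedge`, rank 6, THE BET): `∃U₁>0 ∃δ∈[1/10,2/5] ∀U∈(0,U₁] ∀K>0, K·U ≤ 1/20 →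
RUNG(U,δ,K) → (summit conclusion at (U,δ))`, RUNG = every-GS d-wave order `c L⁴ ≤ re⟨ψ,P_Lψ⟩` of the
seeded torus `H_L(U,g) = hubbardTorus 2 L 1 U − (g/L²)P_L` for all seeds `g ∈ [K·U, 1/10]`.

VERDICT (gen 3, cycle 2, v2.1 — unchanged in substance, sharpened in form): the crux RESISTS. By
`not_tip_iff` a kill needs, at EVERY `δ ∈ [1/10,2/5]` and for arbitrarily small `U > 0`, BOTH every-GS
d-wave LRO of the O(1)-seeded (`g = 1/20`) repulsive torus AND a dark ground-state branch of the PURE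
torus — the first an unproved (t = 1, U > 0) every-GS BCS theorem, the second the negation of the
weak-coupling consensus (d_{x²−y²} leading for `0.6 < n < 1` at `t' = 0`, see Literature below; the
`U → 0` map puts a triplet `p'` pocket at `0.5 < n < 0.6`, i.e. AT the window's edge `δ = 2/5`, harmless
for `∃δ`). New this generation: under the anchor the Tip is LITERALLY the `U`-uniform summit (§11); the
corner `g = 0` is put in normal form on both sides by Danskin/compactness (§14, landed): the
suppression-cost / energy-inequality reformulation IS the conclusion, and g-UNIFORM rungs give exactly an
ordered ground-state BRANCH (an `∃`-GS summit) and — abstractly, §13 — nothing more. Everything below is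
sorry-free (`lean check` rc 0, 0 warnings).

## LANDED through the gate (importable, sorry-free, `Theorems/TwTipContinuation/Negative/`, namespace
`Summit.HubbardSuperconductivity.TwTipContinuation.Negative`)
* gen 2: `SeededChords.lean` (p69944: GS existence, `expect_pairIntensity_mono`, left/right chords,
  `sectorEnergy_antitone`, `chord_slope_mono`), `TipNormalForm.lean` (p70251: `everyGSOrder_mono`,
  `summitMatrix_iff_everyGSOrder`, `twTipContinuation_iff_threshold`, `not_twTipContinuation_iff`,
  `twTipContinuation_of_anchorFailure`, `twTipContinuation_of_uniformSummit`, `not_summitMatrix_of_darkSeed`),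
  `AbstractTipShapeFalse.lean` (p70129: `not_abstractTipShape`), `TipCornerTools.lean` (p70460:
  `everyGSOrder_pure_of_suppressionCost`, `linearGain_of_everyGSOrder_pure`, `not_summitMatrix_of_sublinearGain`).
* gen 3 (this cycle): `SeedContinuity.lean` (p71131 @2b3cbab59d9d: `sectorEnergy_sub_le_mul`,
  `abs_sectorEnergy_sub_le`, `continuous_sectorEnergy`, `groundState_of_tendsto` = CLOSURE of sector ground
  states under limits, `exists_tendsto_subseq_unit`, `exists_suppressionCost_of_forall_groundState` =
  Danskin penalty side, `exists_groundState_order_of_uniformSeeds` = Danskin attractive side);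
  `UniformRungsShapeFalse.lean` (p71220 @c0d8c605abb9: `not_abstractUniformRungsShape`);
  `CornerDanskin.lean` (p74363 @0e80ccf8b61d: `suppressionCost_of_everyGSOrder_pure`,
  `everyGSOrder_pure_iff_suppressionCost`, `existsGSOrder_pure_of_uniformRungs`,
  `existsAdmissibleLRO_of_uniformRungs`).

## Findings (index)

* §0 READBACK (`tip_iff`, `summit_iff`, `Iff.rfl`): vocabulary `seededH`, `pairIntensity`, `pairNumber`,
  `OrderBound U δ g` (the RUNG body at one seed), `RungSeeds`, `SummitAt`.
* §1 COLLAPSE (`tip_iff_fixedSeeds`): `∀K` after `∀U` under `K·U ≤ 1/20` makes the Tip EQUIVALENT to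
  its instance `K = 1/(20U)`: only seeds `g ∈ [1/20, 1/10]` are ever consumed.
* §2 `seeded_sector_groundState`, `exists_unit_groundState`: sector ground states of `H_L(U,g)` exist —
  RUNG is never vacuous for lack of ground states.
* §3 MONOTONICITY (`expect_pairIntensity_mono`, `orderBound_mono`, `rungSeeds_iff_orderBound`): the order
  indicator is an UP-SET in `g`; RUNG over `[g₀,1/10]` = RUNG at `g₀`.
* §4 `summitAt_iff_orderBound_zero` (`δ ≥ −1`): the summit's matrix at `(U,δ)` IS `OrderBound U δ 0`.
* §5 NORMAL FORM (`tip_iff_threshold`): Tip ⟺ `∃U₁>0 ∃δ∈[1/10,2/5] ∀U∈(0,U₁], OrderBound U δ (1/20) →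
  OrderBound U δ 0`; `not_tip_iff` (what a kill needs); `tip_of_summitWindow` / `tip_of_anchorFailure`
  (the two ways to be true — the second is a VACUITY HAZARD); `not_summitAt_of_not_orderBound`.
* §6 LOAD-BEARING SHAPE: normalisation clause (`not_orderBoundNoNorm`, `tipNoNormRung_trivial`), window
  (`not_orderBound_of_one_le`, `tipShape_of_one_le_mem`), `0 < K` idle (`tip_iff_nonnegK`).
* §7 CHORDS (`leftChord_le_order`, `order_le_rightChord`, `sectorEnergy_antitone`, `chord_slope_mono`;
  corner: `orderBound_zero_of_suppressionCost`, `linearGain_of_orderBound`,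
  `not_orderBound_of_sublinearGain`, `not_summitAt_of_sublinearGain`).
* §8 TOY `not_abstract_tipShape` (level crossing INSIDE `(0,1/20)`).
* §9 `TipAlongWedge` normal form (reviewers' re-signature; same vacuity shape).
* §10 `weakTip_does_not_assemble` (`∃δ` before `∀U` is load-bearing for the Assembly).
* §11 (gen 3) **UNDER THE ANCHOR THE TIP IS THE UNIFORM SUMMIT**: `tip_iff_summitWindow_of_rung`
  (`TwSeededRung → (TwTipContinuation ↔ SummitWindow)`), `thesis_iff_rung_and_summitWindow`
  (`Rung ∧ Tip ⟺ Rung ∧ SummitWindow`), `summit_of_summitWindow`, `summitWindow_iff_orderBoundWindow` —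
  the irreducible content of the crux is `∃U₁ ∃δ ∀U≤U₁, OrderBound U δ 0`.
* §12 (gen 3) MOMENTS ENDGAME (line `ground-space-second-moment`): `not_pinning_without_spread` (T2
  necessary), `not_pinning_without_degeneracyBound` (T3 necessary: spread `1/(d−1) → 0` with a dark state).
* §13 (gen 3) TOY `not_abstract_uniformRungsShape` (landed): even g-UNIFORM rungs on all of `(0,1/10]` do not
  give every-GS order at `0` abstractly (`A₀ = 0`, `P = diag(0,40)`: exact crossing AT the corner); only an
  `∃`-GS conclusion survives.
* §14 (gen 3) **DANSKIN AT THE CORNER** (compactness; landed one-side facts): `suppressionCost_iff_orderBound_zero`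
  (`SuppressionCost U δ ⟺ OrderBound U δ 0`: the isogap line's sliver stub IS the conclusion at `(U,δ)`),
  `existsGSOrder_of_uniformRungs` (`UniformRungs → ExistsGSOrder`: CornerPersistence-type hypotheses prove an
  `∃`-GS summit), `orderBound_of_uniformRungs`, `corner_summary`. CONSEQUENCE FOR EVERY LINE: a proof of the
  crux = (a) an `∃`-GS / g-uniform statement reachable from `g > 0` PLUS (b) exclusion of a dark ground state
  of the pure torus coexisting with the ordered branch at the same `(U,δ,L)` — part (b) (moments T2+T3,
  `groundSpaceHomogeneity`, twist-gap rigidity) is untouched by any `g > 0` or `T > 0` input.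

* §15 (gen 3) **TARGETS — picked line `isogap-submodular-transport`** (PICKED.md 01:22Z, skeleton
  `Lines/isogap-submodular-transport.lean`): `danskinAttainment` = the lead's `stub_danskinAttainment` PROVED
  (verbatim signature; evidence `DanskinAttainmentProof.lean`; the lead LANDED it at 01:39Z as
  `Theorems/ThermalWedgeTwTipContinuationDanskinAttainment.lean` on top of `Negative/SeedContinuity.lean`);
  `StubEdgeOrder`, `StubIsogapTransport` (`stubIsogapTransport_iff`, `Iff.rfl` readback) resist cheap attacks;
  `existsGSOrderWindow_of_transport_edge`: transport + edge order (+ Danskin) give EXACTLY the `∃`-GS summit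
  `ExistsGSOrderWindow` — the every-GS content of the crux sits entirely in `stub_groundSpaceHomogeneity`.

## Targets (payload `targets = []` at arming; line picked DURING this cycle)
Line `isogap-submodular-transport`, 4 stubs: `stub_danskinAttainment` — PROVED (§15; landed by the lead 01:39Z via
`Negative/SeedContinuity.lean`); the lead also landed `…EdgeOrderChord.lean` (edgeOrder ⇐ extensive gap
`κL² ≤ E_L(0,0) − E_L(0,c)`) and `…GroundSpaceHomogeneity.lean` (homogeneity ⇐ scalar-on-ground / lattice
irreducibility / simplicity; open part = accidental degeneracies) at 01:58–02:08Z; `stub_edgeOrder` — bet (classical reduced-BCS every-GS order at the U=0 edge; seniority / nodal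
inert levels checked: degenerate ground states share the active paired part, hence `re⟨P_L⟩` — no cheap kill);
`stub_isogapTransport` — crux-sized bet (falsifier = sign of `a₂(δ)`; take `δ ∈ [0.1,0.3]`, NOT `2/5`: triplet
`p′` pocket at `0.5<n<0.6` as `U→0`, Literature); `stub_groundSpaceHomogeneity` — bet; SHARPEN: it is typed
`∀δ ∈ [1/10,2/5]` but only the transport's `δ` is consumed by `TwTipContinuation_of` (an `∃δ`-matched /
`δ`-parametrised form is strictly weaker and suffices); as typed it also demands homogeneity at `δ = 2/5` where the
`U → 0` ground state is not d_{x²−y²}. No stub is false as typed by any cheap test (window, normalisation,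
`NeZero`, eventual-in-`L`, `s ∈ Ioc/Ioo` edges all sound).

## Literature (page hits, gen 2 + gen 3)
* Raghu–Kivelson–Scalapino PRB 81 (2010) 224505 = arXiv:1002.0591 p.7: at `t'=0` "d_{x²−y²} ground state for
  `1 > n > 0.6`, d_xy for `n < 0.6`".
* Šimkovic–Liu–Deng–Kozik, PRB 94 (2016) 085106 = arXiv:1512.04271 (materialised gen 3), p.8: "the p^(6)
  phase, which occupies a significant region in the U → 0 limit (… at t'=0, n ∼ 0.6) vanishes already at
  U = 0.08"; "The d_{x²−y²}^(4) state dominates in a wide region around half filling"; p.10: "the p^(6) phase at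
  t'=0 was overlooked in [RKS2010] due to a low number of harmonics … found here as well as in [Hlubina 1999]";
  RKS's λ "missing a factor of density of states" (overestimate ×40 near half filling).
* Deng–Kozik–Prokof'ev–Svistunov EPL 110 (2015) 57001 = arXiv:1408.2088 p.2: "the pocket of the p′ phase at
  0.5 < n < 0.6 vanishes already at U ≳ 0.08"; near-vertical d_xy/d_{x²−y²} boundary at n ≈ 0.6.
  UPSHOT for the crux: in the strict `∀U ≤ U₁` (U → 0) reading the edge `δ = 2/5` (n = 0.6) is inside/next to
  a TRIPLET p′ pocket and the d_xy boundary — the `∃δ` witness must be `δ ∈ [0.1, 0.3]` (n ∈ [0.7, 0.9], deep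
  in the d_{x²−y²}^{(4)} region of all three maps). No printed result contradicts d_{x²−y²} leadership there.
* `lit search` (searchd) unavailable again this session (rc 75); galaxy substring sweep "Kohn-Luttinger"
  (pdf star, 30 rows) surfaced nothing on rigorous negative results; `ledger negatives`: stmt-1314 only.
* Barriers: `PerturbativeInvisibilityOfPairing`, `WeakCouplingCeiling`, `PureModelStripeCompetition` — none
  bites the Tip as typed; none helps prove it (unchanged).

## Compute
None run. Reason (numbers): ED-reachable tori (`L = 4`, sector `(5,5)`, dim `1.9·10⁷`) have level spacing
`2t` ≫ seeded gap `W e^{−20/ρ_d} ≲ e^{−60}W` at `g = 1/20` and ≫ the KL scale `W e^{−1/(λ)}`, `λ/U² ≤ 0.05`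
(Šimkovic 2016 p.9: `λ/U² = 0.0481` at the AFM point is the MAXIMUM near half filling) — nothing decidable at
small size bears on `g⋆(U,δ) ∉ (0,1/20]`; the ideator's KL design check j006254 (leading channel vs n) exists
as item evidence but is not readable by this identity.
-/

noncomputable section

set_option linter.dupNamespace false

namespace Summit.HubbardSuperconductivity.HubbardSuperconductivity.Cruxes.TwTipContinuation.Disproof

open Matrix Filter Finset
open Literature.MathematicalPhysics.QuantumLattice Literature.Probability.LatticeModels
open Summit.HubbardSuperconductivity.HubbardSuperconductivity.Theses.ThermalWedge
open scoped ComplexOrder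

/-! ## §0 Readback vocabulary (all `def`/`abbrev` unfold to the crux's literal sub-terms) -/

/-- `P_L = (pairField d L)ᴴ (pairField d L) = 2 Δ_d† Δ_d`, the d-wave pair intensity. [folklore] -/
abbrev pairIntensity (L : ℕ) [NeZero L] :
    Matrix (Finset (Orb (FermionTorus 2 L))) (Finset (Orb (FermionTorus 2 L))) ℂ :=
  (pairField dWaveFormFactor L)ᴴ * pairField dWaveFormFactor L

/-- The seeded Hamiltonian `H_L(U,g) = hubbardTorus 2 L 1 U − (g/L²) P_L`. [folklore] -/
abbrev seededH (U g : ℝ) (L : ℕ) [NeZero L] :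
    Matrix (Finset (Orb (FermionTorus 2 L))) (Finset (Orb (FermionTorus 2 L))) ℂ :=
  hubbardTorus 2 L 1 U - ((g / (L : ℝ) ^ 2 : ℝ) : ℂ) • pairIntensity L

/-- `N_L/2 = ⌊(1-δ)L²/2⌋` (pairs). [folklore] -/
abbrev halfN (δ : ℝ) (L : ℕ) : ℕ := ⌊(1 - δ) * (L : ℝ) ^ 2 / 2⌋₊

/-- `N_L = 2⌊(1-δ)L²/2⌋`. [folklore] -/
abbrev pairNumber (δ : ℝ) (L : ℕ) : ℕ := 2 * halfN δ L

/-- The ORDER INDICATOR at seed `g`: an eventual (even `L ≥ L₀`), uniform, EVERY-ground-state lower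
bound `c L⁴ ≤ re ⟨ψ, P_L ψ⟩` in the summit's sector for `H_L(U,g)`. This is literally the body of the
crux's RUNG hypothesis at one seed. [folklore] -/
def OrderBound (U δ g : ℝ) : Prop :=
  ∃ c : ℝ, 0 < c ∧ ∃ L₀ : ℕ, ∀ (L : ℕ) [NeZero L], L₀ ≤ L → Even L →
    ∀ ψ : Fock (Orb (FermionTorus 2 L)), star ψ ⬝ᵥ ψ = 1 →
      IsGroundStateInSector (seededH U g L) (pairNumber δ L) 0 ψ →
        c * (L : ℝ) ^ 4 ≤ (expect (pairIntensity L) ψ).re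

/-- RUNG(U,δ,g₀): the order indicator lit on the whole seed band `[g₀, 1/10]`. [folklore] -/
def RungSeeds (U δ g₀ : ℝ) : Prop := ∀ g ∈ Set.Icc g₀ (1 / 10 : ℝ), OrderBound U δ g

/-- The summit's conclusion AT the parameter point `(U, δ)` (literally the matrix of
`Literature.Hubbard.DWaveSuperconductivityHubbard`). [folklore] -/
def SummitAt (U δ : ℝ) : Prop :=
  ∀ (N : ℕ → ℕ) (ψ : ∀ L, Fock (Orb (FermionTorus 2 L))),
    (∀ L, Even L → N L = pairNumber δ L ∧ star (ψ L) ⬝ᵥ ψ L = 1 ∧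
        IsGroundStateInSector (hubbardTorus 2 L 1 U) (N L) 0 (ψ L)) →
      HasLongRangeOrder (fun k => halfOpenBox 2 (2 * k))
        (fun k => torusPullback (pairFieldCorr dWaveFormFactor ψ) (2 * k))

/-- READBACK (`Iff.rfl`): the crux is `∃U₁>0 ∃δ∈[1/10,2/5] ∀U∈(0,U₁] ∀K>0, K·U ≤ 1/20 →
RungSeeds U δ (K·U) → SummitAt U δ`. [folklore] -/
theorem tip_iff :
    TwTipContinuation ↔
      ∃ U₁ : ℝ, 0 < U₁ ∧ ∃ δ ∈ Set.Icc (1 / 10 : ℝ) (2 / 5), ∀ U ∈ Set.Ioc (0 : ℝ) U₁,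
        ∀ K : ℝ, 0 < K → K * U ≤ 1 / 20 → RungSeeds U δ (K * U) → SummitAt U δ :=
  Iff.rfl

/-- READBACK: the summit itself is `∃ U > 0, ∃ δ ∈ (0,1/2), SummitAt U δ`. [folklore] -/
theorem summit_iff : HubbardSuperconductivity ↔ ∃ U : ℝ, 0 < U ∧ ∃ δ ∈ Set.Ioo (0 : ℝ) (1 / 2), SummitAt U δ :=
  Iff.rfl

/-! ## §1 Collapse of `∀ K` (quantifier order): the Tip only ever consumes the seeds `[1/20, 1/10]` -/

/-- RUNG is monotone in its lower seed edge. [folklore] -/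
theorem rungSeeds_mono {U δ g₀ g₀' : ℝ} (h : g₀ ≤ g₀') (hR : RungSeeds U δ g₀) :
    RungSeeds U δ g₀' :=
  fun g hg => hR g ⟨h.trans hg.1, hg.2⟩

/-- The Tip with the U-INDEPENDENT seed band `[1/20, 1/10]` as its only hypothesis. [folklore] -/
def TipFixedSeeds : Prop :=
  ∃ U₁ : ℝ, 0 < U₁ ∧ ∃ δ ∈ Set.Icc (1 / 10 : ℝ) (2 / 5), ∀ U ∈ Set.Ioc (0 : ℝ) U₁,
    RungSeeds U δ (1 / 20) → SummitAt U δ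

/-- **Collapse.** Because `K` is quantified AFTER `U` under the sole constraint `K·U ≤ 1/20`, the
instance `K := 1/(20U)` must hold, and it implies all others (RUNG is monotone in its lower edge):
`TwTipContinuation ⟺ TipFixedSeeds`. The anchor's seeds `g = K·U` comparable with the bare `U`
never enter. (Concurs with the three route reviews and gen-1 §1.) [folklore] -/
theorem tip_iff_fixedSeeds : TwTipContinuation ↔ TipFixedSeeds := by
  rw [tip_iff]
  constructor
  · rintro ⟨U₁, hU₁, δ, hδ, h⟩
    refine ⟨U₁, hU₁, δ, hδ, fun U hU hR => ?_⟩
    have hUpos : 0 < U := hU.1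
    have hK : 0 < 1 / (20 * U) := by positivity
    have hKU : 1 / (20 * U) * U = 1 / 20 := by field_simp
    exact h U hU _ hK hKU.le (hKU ▸ hR)
  · rintro ⟨U₁, hU₁, δ, hδ, h⟩
    exact ⟨U₁, hU₁, δ, hδ, fun U hU K _ hKU hR => h U hU (rungSeeds_mono hKU hR)⟩

/-! ## §2 The seeded Hamiltonian: Hermitian, `(N↑,N↓)`-block-diagonal, sector ground states exist -/

section Seeded

variable (U g : ℝ) (L : ℕ) [NeZero L]

/-- `P_L ≥ 0`. [folklore] -/
theorem pairIntensity_posSemidef : (pairIntensity L).PosSemidef :=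
  pairField_conjTranspose_mul_self_posSemidef dWaveFormFactor L

/-- `re ⟨ψ, P_L ψ⟩ = ‖Δ ψ‖² ≥ 0`. [folklore] -/
theorem expect_pairIntensity_nonneg (ψ : Fock (Orb (FermionTorus 2 L))) :
    0 ≤ (expect (pairIntensity L) ψ).re := by
  rw [PosSemidefTrace.expect_conjTranspose_mul, ← norm_toLp_sq_eq_re]
  positivity

/-- `H_L(U,g)` is Hermitian (real seed). [folklore] -/
theorem seededH_isHermitian : (seededH U g L).IsHermitian := by
  have h1 : (hubbardTorus 2 L 1 U).IsHermitian := LiebThm1.hamiltonian_isHermitian _ 1 U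
  have h2 : (pairIntensity L).IsHermitian := (pairIntensity_posSemidef L).isHermitian
  refine h1.sub ?_
  unfold Matrix.IsHermitian
  rw [conjTranspose_smul, h2.eq, Complex.star_def, Complex.conj_ofReal]

/-- `pairField` lowers `(N↑, N↓)` by `(1, 1)`. [folklore] -/
theorem shifts_pairField (g' : Site 2 → ℝ) : PairChirality.Shifts (-1) (-1) (pairField g' L) :=
  PairChirality.Shifts.sum fun x _ => PairChirality.shifts_localPair L g' x

/-- `P_L` conserves `N↑` and `N↓`. [folklore] -/
theorem preservesSectors_pairIntensity : PreservesSectors (pairIntensity L) := by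
  have h := (shifts_pairField L dWaveFormFactor).conjTranspose.mul (shifts_pairField L dWaveFormFactor)
  simp only [Int.reduceNeg, neg_neg, add_neg_cancel] at h
  exact h.preservesSectors

/-- `H_L(U,g)` conserves `N↑` and `N↓`. [folklore] -/
theorem preservesSectors_seededH : PreservesSectors (seededH U g L) := by
  have h1 := LiebThm1.preservesSectors_hamiltonian (fermionTorusGraph 2 L) 1 U
  have h2 := (preservesSectors_pairIntensity L).smul (-(((g / (L : ℝ) ^ 2 : ℝ) : ℂ)))
  have h3 : seededH U g L =
      hubbardTorus 2 L 1 U + (-(((g / (L : ℝ) ^ 2 : ℝ) : ℂ))) • pairIntensity L := by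
    rw [neg_smul, ← sub_eq_add_neg]
  rw [h3]
  exact h1.add h2

omit [NeZero L] in
/-- A nonzero vector of the `(n,n)` sector forces `n ≤ |Λ_L|`. [folklore] -/
theorem le_card_of_mem_szSector {n : ℕ} {ψ : Fock (Orb (FermionTorus 2 L))}
    (hψ : ψ ∈ szSector (Λ := FermionTorus 2 L) (2 * n) (0 : ℝ)) (hne : ψ ≠ 0) :
    n ≤ Fintype.card (FermionTorus 2 L) := by
  by_contra hlt
  have hlt' := not_le.mp hlt
  apply hne
  funext s
  refine (mem_szSector_two_mul_zero_iff n ψ).1 hψ s fun h => ?_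
  have : (upPart s).card ≤ Fintype.card (FermionTorus 2 L) := Finset.card_le_univ _
  omega

/-- **Sector ground states of the seeded Hamiltonian exist, and the sector energy is a variational
lower bound** (`sector_groundState` applied to the `(n,n)` coordinate sector; RUNG is never vacuous
for lack of ground states). Tasaki (2020) §2.2. [folklore] -/
theorem seeded_sector_groundState {n : ℕ} (hn : n ≤ Fintype.card (FermionTorus 2 L)) :
    (∃ ψ, IsGroundStateInSector (seededH U g L) (2 * n) 0 ψ) ∧
      ∀ v ∈ szSector (Λ := FermionTorus 2 L) (2 * n) (0 : ℝ), star v ⬝ᵥ v = 1 →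
        (seededH U g L).minEnergyOn (szSector (2 * n) 0) ≤ (expect (seededH U g L) v).re := by
  classical
  obtain ⟨α₀, -, hα₀⟩ : ∃ α₀ : Finset (FermionTorus 2 L), α₀ ⊆ univ ∧ α₀.card = n :=
    Finset.exists_subset_card_eq (by rwa [Finset.card_univ])
  have hp : ∃ s : Finset (Orb (FermionTorus 2 L)), (upPart s).card = n ∧ (downPart s).card = n :=
    ⟨pairSet α₀ α₀, by rw [upPart_pairSet, hα₀], by rw [downPart_pairSet, hα₀]⟩
  have hinv : ∀ s s' : Finset (Orb (FermionTorus 2 L)),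
      ¬((upPart s).card = n ∧ (downPart s).card = n) →
      ((upPart s').card = n ∧ (downPart s').card = n) → seededH U g L s s' = 0 := by
    intro s s' hs hs'
    by_contra h
    have := preservesSectors_seededH U g L s s' h
    exact hs ⟨this.1.trans hs'.1, this.2.trans hs'.2⟩
  have hK : ∀ v : Fock (Orb (FermionTorus 2 L)), v ∈ szSector (2 * n) (0 : ℝ) ↔
      ∀ s, ¬((upPart s).card = n ∧ (downPart s).card = n) → v s = 0 :=
    fun v => mem_szSector_two_mul_zero_iff n v
  obtain ⟨⟨v, hv, hv0, hHv⟩, hb⟩ := sector_groundState (seededH U g L)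
    (seededH_isHermitian U g L) (fun s => (upPart s).card = n ∧ (downPart s).card = n)
    hp hinv (szSector (2 * n) 0) hK
  exact ⟨⟨v, hv, hv0, hHv⟩, hb⟩

/-- Normalised sector ground states of `H_L(U,g)` exist in every sector `(2n, 0)`, `n ≤ L²`. [folklore] -/
theorem exists_unit_groundState {n : ℕ} (hn : n ≤ Fintype.card (FermionTorus 2 L)) :
    ∃ ψ : Fock (Orb (FermionTorus 2 L)), star ψ ⬝ᵥ ψ = 1 ∧
      IsGroundStateInSector (seededH U g L) (2 * n) 0 ψ := by
  obtain ⟨⟨ψ, hψ⟩, -⟩ := seeded_sector_groundState U g L hn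
  obtain ⟨c, hc, hc1⟩ := exists_smul_unit hψ.2.1
  exact ⟨c • ψ, hc1, Summit.HubbardSuperconductivity.NoGo.isGroundStateInSector_smul _ _ _ hψ hc⟩

omit [NeZero L] in
/-- For a normalised sector ground state, `⟨ψ, H ψ⟩` is the sector energy. [folklore] -/
theorem expect_eq_of_groundState {H : Matrix (Finset (Orb (FermionTorus 2 L))) (Finset (Orb (FermionTorus 2 L))) ℂ}
    {N : ℕ} {M : ℝ} {ψ : Fock (Orb (FermionTorus 2 L))} (hψ1 : star ψ ⬝ᵥ ψ = 1)
    (h : IsGroundStateInSector H N M ψ) :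
    expect H ψ = ((H.minEnergyOn (szSector N M) : ℝ) : ℂ) := by
  rw [Literature.MathematicalPhysics.QuantumLattice.expect, h.2.2, dotProduct_smul, hψ1, smul_eq_mul, mul_one]

/-- Seeds differ by a multiple of `P_L`: `H(g') = H(g) − ((g'−g)/L²) P_L`. [folklore] -/
theorem seededH_eq_sub (g' : ℝ) :
    seededH U g' L = seededH U g L - (((g' - g) / (L : ℝ) ^ 2 : ℝ) : ℂ) • pairIntensity L := by
  simp only [seededH]
  rw [sub_sub, ← add_smul]
  congr 2
  push_cast
  ring

omit [NeZero L] in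
/-- `⟨ψ,(A − B)ψ⟩ = ⟨ψ,Aψ⟩ − ⟨ψ,Bψ⟩`. [folklore] -/
theorem expect_sub' (A B : Matrix (Finset (Orb (FermionTorus 2 L))) (Finset (Orb (FermionTorus 2 L))) ℂ)
    (ψ : Fock (Orb (FermionTorus 2 L))) : expect (A - B) ψ = expect A ψ - expect B ψ := by
  simp [Literature.MathematicalPhysics.QuantumLattice.expect, sub_mulVec, dotProduct_sub]

/-- `re ⟨ψ, H(g')ψ⟩ = re ⟨ψ, H(g)ψ⟩ − ((g'−g)/L²) re ⟨ψ, P_L ψ⟩`. [folklore] -/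
theorem expect_seededH_re (g' : ℝ) (ψ : Fock (Orb (FermionTorus 2 L))) :
    (expect (seededH U g' L) ψ).re =
      (expect (seededH U g L) ψ).re - (g' - g) / (L : ℝ) ^ 2 * (expect (pairIntensity L) ψ).re := by
  rw [seededH_eq_sub U g L g', expect_sub', expect_smul, Complex.sub_re, Complex.re_ofReal_mul]

/-- At `g = 0` the seeded Hamiltonian is the pure Hubbard torus. [folklore] -/
theorem seededH_zero : seededH U 0 L = hubbardTorus 2 L 1 U := by
  simp only [seededH, zero_div, Complex.ofReal_zero, zero_smul, sub_zero]

end Seeded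

/-! ## §3 Monotonicity in the seed: the order indicator is an up-set in `g` -/

/-- **Every ground state at a larger seed carries at least the pair intensity of every ground state
at a smaller seed** (sum of the two variational inequalities; exact at finite `L`).
[folklore] -/
theorem expect_pairIntensity_mono {U : ℝ} {L : ℕ} [NeZero L] {n : ℕ} {g₁ g₂ : ℝ} (hg : g₁ < g₂)
    {ψ₁ ψ₂ : Fock (Orb (FermionTorus 2 L))} (h₁u : star ψ₁ ⬝ᵥ ψ₁ = 1) (h₂u : star ψ₂ ⬝ᵥ ψ₂ = 1)
    (h₁ : IsGroundStateInSector (seededH U g₁ L) (2 * n) 0 ψ₁)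
    (h₂ : IsGroundStateInSector (seededH U g₂ L) (2 * n) 0 ψ₂) :
    (expect (pairIntensity L) ψ₁).re ≤ (expect (pairIntensity L) ψ₂).re := by
  have hn : n ≤ Fintype.card (FermionTorus 2 L) := le_card_of_mem_szSector L h₁.1 h₁.2.1
  obtain ⟨-, hb₁⟩ := seeded_sector_groundState U g₁ L hn
  obtain ⟨-, hb₂⟩ := seeded_sector_groundState U g₂ L hn
  have e₁ : (expect (seededH U g₁ L) ψ₁).re = (seededH U g₁ L).minEnergyOn (szSector (2 * n) 0) := by
    rw [expect_eq_of_groundState L h₁u h₁, Complex.ofReal_re]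
  have e₂ : (expect (seededH U g₂ L) ψ₂).re = (seededH U g₂ L).minEnergyOn (szSector (2 * n) 0) := by
    rw [expect_eq_of_groundState L h₂u h₂, Complex.ofReal_re]
  have v₁ : (seededH U g₁ L).minEnergyOn (szSector (2 * n) 0) ≤ (expect (seededH U g₁ L) ψ₂).re :=
    hb₁ ψ₂ h₂.1 h₂u
  have v₂ : (seededH U g₂ L).minEnergyOn (szSector (2 * n) 0) ≤ (expect (seededH U g₂ L) ψ₁).re :=
    hb₂ ψ₁ h₁.1 h₁u
  have r₁ := expect_seededH_re U g₁ L g₂ ψ₁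
  have r₂ := expect_seededH_re U g₁ L g₂ ψ₂
  have hL : (0 : ℝ) < (L : ℝ) ^ 2 := by
    have := NeZero.pos L
    positivity
  have hc : 0 < (g₂ - g₁) / (L : ℝ) ^ 2 := div_pos (sub_pos.2 hg) hL
  have key : (g₂ - g₁) / (L : ℝ) ^ 2 * (expect (pairIntensity L) ψ₁).re ≤
      (g₂ - g₁) / (L : ℝ) ^ 2 * (expect (pairIntensity L) ψ₂).re := by
    linarith
  exact le_of_mul_le_mul_left key hc

/-- **The order indicator is an up-set in the seed**: `OrderBound U δ g₁ → OrderBound U δ g₂` for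
`g₁ ≤ g₂` (same constant, same `L₀`). [folklore] -/
theorem orderBound_mono {U δ g₁ g₂ : ℝ} (hg : g₁ ≤ g₂) (h : OrderBound U δ g₁) : OrderBound U δ g₂ := by
  rcases eq_or_lt_of_le hg with rfl | hlt
  · exact h
  obtain ⟨c, hc, L₀, hL⟩ := h
  refine ⟨c, hc, L₀, fun L _ hL₀ hE ψ hψ hgs => ?_⟩
  have hn := le_card_of_mem_szSector L hgs.1 hgs.2.1
  obtain ⟨ψ₁, hψ₁, hgs₁⟩ := exists_unit_groundState U g₁ L hn
  exact (hL L hL₀ hE ψ₁ hψ₁ hgs₁).trans (expect_pairIntensity_mono hlt hψ₁ hψ hgs₁ hgs)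

/-- RUNG over a seed band is RUNG at its lower edge: `RungSeeds U δ g₀ ⟺ OrderBound U δ g₀`
(`g₀ ≤ 1/10`). The anchor's seed INTERVAL is one seed. [folklore] -/
theorem rungSeeds_iff_orderBound {U δ g₀ : ℝ} (hg₀ : g₀ ≤ 1 / 10) :
    RungSeeds U δ g₀ ↔ OrderBound U δ g₀ :=
  ⟨fun h => h g₀ ⟨le_rfl, hg₀⟩, fun h _ hg => orderBound_mono hg.1 h⟩


/-! ## §4 The summit's conclusion at `(U,δ)` IS the order indicator at seed `0` -/

/-- The LRO sequence of the summit's conclusion (even sides `2k`; value `0` at `k = 0`). [folklore] -/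
def lroSeq (ψ : ∀ L, Fock (Orb (FermionTorus 2 L))) (k : ℕ) : ℝ :=
  (∑ x ∈ halfOpenBox 2 (2 * k), ∑ y ∈ halfOpenBox 2 (2 * k),
      torusPullback (pairFieldCorr dWaveFormFactor ψ) (2 * k) x y) /
    ((halfOpenBox 2 (2 * k)).card : ℝ) ^ 2

/-- READBACK of the conclusion's `HasLongRangeOrder` as `0 < liminf_k lroSeq ψ k`. [folklore] -/
theorem hasLRO_iff_lroSeq (ψ : ∀ L, Fock (Orb (FermionTorus 2 L))) :
    HasLongRangeOrder (fun k => halfOpenBox 2 (2 * k))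
        (fun k => torusPullback (pairFieldCorr dWaveFormFactor ψ) (2 * k)) ↔
      0 < liminf (lroSeq ψ) atTop :=
  Iff.rfl

/-- `Σ_{x,y} G_L(x,y) = re ⟨ψ_L, Δᴴ Δ ψ_L⟩` at every nonzero side. [folklore] -/
theorem sum_pairFieldCorr (g : Site 2 → ℝ) (ψ : ∀ L, Fock (Orb (FermionTorus 2 L))) (L : ℕ)
    [NeZero L] :
    ∑ x : TorusSite 2 L, ∑ y, pairFieldCorr g ψ L x y =
      (expect ((pairField g L)ᴴ * pairField g L) (ψ L)).re := by
  obtain ⟨L', rfl⟩ := Nat.exists_eq_add_one_of_ne_zero (NeZero.ne L)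
  exact sum_pairFieldCorr_succ g ψ L'

/-- The normalised pull-back double sum at a nonzero side is the normalised torus double sum. [folklore] -/
theorem sum_torusPullback (G : (L : ℕ) → TorusSite 2 L → TorusSite 2 L → ℝ) (L : ℕ) [NeZero L] :
    (∑ x ∈ halfOpenBox 2 L, ∑ y ∈ halfOpenBox 2 L, torusPullback G L x y) /
        ((halfOpenBox 2 L).card : ℝ) ^ 2 =
      (∑ x : TorusSite 2 L, ∑ y : TorusSite 2 L, G L x y) / (L : ℝ) ^ 4 := by
  obtain ⟨L', rfl⟩ := Nat.exists_eq_add_one_of_ne_zero (NeZero.ne L)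
  rw [sum_torusPullback_succ (d := 2) G L']

/-- At a nonzero even side the LRO sequence is `re ⟨ψ_{2k}, P_{2k} ψ_{2k}⟩ / (2k)⁴`. [folklore] -/
theorem lroSeq_eq (ψ : ∀ L, Fock (Orb (FermionTorus 2 L))) (k : ℕ) [NeZero (2 * k)] :
    lroSeq ψ k = (expect (pairIntensity (2 * k)) (ψ (2 * k))).re / ((2 * k : ℕ) : ℝ) ^ 4 := by
  rw [lroSeq, sum_torusPullback, sum_pairFieldCorr]

/-- `0 < (2k)⁴` as a real number once `2k ≠ 0`. [folklore] -/
theorem side_pow_pos (k : ℕ) [NeZero (2 * k)] : (0 : ℝ) < ((2 * k : ℕ) : ℝ) ^ 4 :=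
  pow_pos (Nat.cast_pos.2 (Nat.pos_of_ne_zero (NeZero.ne (2 * k)))) 4

/-- The crude constant `C_d² = (Σ_{e ∈ {0} ∪ unitSteps} 2|d(e)|/√2)²` bounding `re⟨P_L⟩/L⁴`. [folklore] -/
def Cd : ℝ := (∑ e ∈ insert 0 unitSteps, ‖((dWaveFormFactor e / Real.sqrt 2 : ℝ) : ℂ)‖ * 2) ^ 2

/-- `re ⟨ψ, P_L ψ⟩ ≤ C_d² L⁴` for unit `ψ` (so every `liminf` below is an honest number). [folklore] -/
theorem expect_pairIntensity_le (L : ℕ) [NeZero L] (ψ : Fock (Orb (FermionTorus 2 L)))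
    (hψ : star ψ ⬝ᵥ ψ = 1) : (expect (pairIntensity L) ψ).re ≤ Cd * (L : ℝ) ^ 4 := by
  classical
  obtain ⟨L', rfl⟩ := Nat.exists_eq_add_one_of_ne_zero (NeZero.ne L)
  set fam : ∀ L, Fock (Orb (FermionTorus 2 L)) := Function.update (fun _ => 0) (L' + 1) ψ with hfam
  have hfamL : fam (L' + 1) = ψ := by simp [hfam]
  have hnorm : star (fam (L' + 1)) ⬝ᵥ fam (L' + 1) = 1 := by rw [hfamL, hψ]
  have hsum := sum_pairFieldCorr_succ dWaveFormFactor fam L'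
  rw [hfamL] at hsum
  rw [← hsum]
  calc ∑ x : TorusSite 2 (L' + 1), ∑ y, pairFieldCorr dWaveFormFactor fam (L' + 1) x y
      ≤ ∑ _x : TorusSite 2 (L' + 1), ∑ _y : TorusSite 2 (L' + 1), Cd :=
        Finset.sum_le_sum fun x _ => Finset.sum_le_sum fun y _ =>
          pairFieldCorr_succ_le dWaveFormFactor fam L' hnorm x y
    _ = Cd * ((L' + 1 : ℕ) : ℝ) ^ 4 := by
        simp only [Finset.sum_const, Finset.card_univ, Fintype.card_pi, ZMod.card,
          Finset.prod_const, Fintype.card_fin, nsmul_eq_mul]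
        push_cast
        ring

/-- The LRO sequence is nonnegative. [folklore] -/
theorem lroSeq_nonneg (ψ : ∀ L, Fock (Orb (FermionTorus 2 L))) (k : ℕ) : 0 ≤ lroSeq ψ k := by
  rcases Nat.eq_zero_or_pos k with rfl | hk
  · simp [lroSeq, card_halfOpenBox]
  · haveI : NeZero (2 * k) := ⟨by omega⟩
    rw [lroSeq_eq]
    exact div_nonneg (expect_pairIntensity_nonneg _ _) (side_pow_pos k).le

/-- **(easy half) the order indicator at seed 0 gives the summit's conclusion at `(U,δ)`.** [folklore] -/
theorem summitAt_of_orderBound_zero {U δ : ℝ} (h : OrderBound U δ 0) : SummitAt U δ := by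
  obtain ⟨c, hc, L₀, hL⟩ := h
  intro N ψ hyp
  rw [hasLRO_iff_lroSeq]
  have hev : ∀ᶠ k in atTop, c ≤ lroSeq ψ k := by
    refine eventually_atTop.2 ⟨L₀ + 1, fun k hk => ?_⟩
    haveI : NeZero (2 * k) := ⟨by omega⟩
    obtain ⟨hN, hu, hgs⟩ := hyp (2 * k) (even_two_mul k)
    rw [hN] at hgs
    have hgs' : IsGroundStateInSector (seededH U 0 (2 * k)) (pairNumber δ (2 * k)) 0 (ψ (2 * k)) := by
      rw [seededH_zero]; exact hgs
    have hb := hL (2 * k) (by omega) (even_two_mul k) (ψ (2 * k)) hu hgs'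
    rw [lroSeq_eq, le_div_iff₀ (side_pow_pos k)]
    exact hb
  have hev' : ∀ᶠ k in atTop, lroSeq ψ k ≤ Cd := by
    refine eventually_atTop.2 ⟨1, fun k hk => ?_⟩
    haveI : NeZero (2 * k) := ⟨by omega⟩
    obtain ⟨-, hu, -⟩ := hyp (2 * k) (even_two_mul k)
    rw [lroSeq_eq, div_le_iff₀ (side_pow_pos k)]
    exact expect_pairIntensity_le (2 * k) (ψ (2 * k)) hu
  exact lt_of_lt_of_le hc (le_liminf_of_le (isCoboundedUnder_ge_of_eventually_le _ hev') hev)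

/-- Badness at level `n` and side `L`: some normalised sector ground state of the PURE model has
pair intensity below `L⁴/(n+1)`. (Bookkeeping device for the hard half.) [folklore] -/
def BadAt (U δ : ℝ) (n L : ℕ) : Prop :=
  ∃ _ : NeZero L, ∃ ψ : Fock (Orb (FermionTorus 2 L)), star ψ ⬝ᵥ ψ = 1 ∧
    IsGroundStateInSector (hubbardTorus 2 L 1 U) (pairNumber δ L) 0 ψ ∧
      (expect (pairIntensity L) ψ).re < 1 / ((n : ℝ) + 1) * (L : ℝ) ^ 4

/-- **(hard half, no compactness) the summit's conclusion at `(U,δ)` forces the order indicator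
at seed 0.** If no uniform every-GS bound holds, a diagonal choice of near-worst ground states
(`Nat.findGreatest` over badness levels) is an admissible sequence whose LRO `liminf` is `≤ 0`. [folklore] -/
theorem orderBound_zero_of_summitAt {U δ : ℝ} (hδ : -1 ≤ δ) (hS : SummitAt U δ) :
    OrderBound U δ 0 := by
  classical
  by_contra hOB
  have key : ∀ n L₀ : ℕ, ∃ L, L₀ ≤ L ∧ Even L ∧ BadAt U δ n L := by
    intro n L₀
    by_contra hno
    apply hOB
    refine ⟨1 / ((n : ℝ) + 1), by positivity, L₀, fun L _ hL₀ hE ψ hψ hgs => ?_⟩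
    by_contra hlt
    have hlt' := not_le.mp hlt
    refine hno ⟨L, hL₀, hE, ‹NeZero L›, ψ, hψ, ?_, hlt'⟩
    simpa only [seededH_zero] using hgs
  let lvl : ℕ → ℕ := fun L => Nat.findGreatest (fun n => BadAt U δ n L) L
  have hspec : ∀ L n, n ≤ L → BadAt U δ n L → BadAt U δ (lvl L) L :=
    fun L n hn hb => Nat.findGreatest_spec (P := fun m => BadAt U δ m L) hn hb
  have hge : ∀ L n, n ≤ L → BadAt U δ n L → n ≤ lvl L :=
    fun L n hn hb => Nat.le_findGreatest (P := fun m => BadAt U δ m L) hn hb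
  have hex : ∀ L, ∃ ψ : Fock (Orb (FermionTorus 2 L)), star ψ ⬝ᵥ ψ = 1 ∧
      IsGroundStateInSector (hubbardTorus 2 L 1 U) (pairNumber δ L) 0 ψ ∧
      (BadAt U δ (lvl L) L → ∃ _ : NeZero L,
        (expect (pairIntensity L) ψ).re < 1 / ((lvl L : ℝ) + 1) * (L : ℝ) ^ 4) := by
    intro L
    by_cases hb : BadAt U δ (lvl L) L
    · obtain ⟨inst, ψ, h1, h2, h3⟩ := hb
      exact ⟨ψ, h1, h2, fun _ => ⟨inst, h3⟩⟩
    · obtain ⟨ψ, h1, h2⟩ :=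
        Summit.HubbardSuperconductivity.NoGo.exists_unit_groundStateInSector_hubbardTorus L 1 U
          (Summit.HubbardSuperconductivity.NoGo.floor_pairNumber_le δ hδ L)
      exact ⟨ψ, h1, h2, fun h => absurd h hb⟩
  choose ψ hψu hψgs hψbad using hex
  have hLRO : 0 < liminf (lroSeq ψ) atTop :=
    (hasLRO_iff_lroSeq ψ).1 (hS (fun L => pairNumber δ L) ψ fun L _ => ⟨rfl, hψu L, hψgs L⟩)
  have hfreq : ∀ ε : ℝ, 0 < ε → ∃ᶠ k in atTop, lroSeq ψ k ≤ ε := by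
    intro ε hε
    obtain ⟨n, hn⟩ := exists_nat_one_div_lt hε
    refine frequently_atTop.2 fun K₀ => ?_
    obtain ⟨L, hL, hE, hbad⟩ := key n (2 * K₀ + n + 2)
    obtain ⟨k, hk⟩ : ∃ k, L = 2 * k := ⟨L / 2, (Nat.two_mul_div_two_of_even hE).symm⟩
    subst hk
    refine ⟨k, by omega, ?_⟩
    haveI : NeZero (2 * k) := ⟨by omega⟩
    have hb' : BadAt U δ (lvl (2 * k)) (2 * k) := hspec _ n (by omega) hbad
    have hnl : n ≤ lvl (2 * k) := hge _ n (by omega) hbad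
    obtain ⟨_, hlt⟩ := hψbad (2 * k) hb'
    have hX : (0 : ℝ) ≤ ((2 * k : ℕ) : ℝ) ^ 4 := by positivity
    have h1 : 1 / ((lvl (2 * k) : ℝ) + 1) ≤ 1 / ((n : ℝ) + 1) :=
      one_div_le_one_div_of_le (by positivity) (by exact_mod_cast Nat.succ_le_succ hnl)
    rw [lroSeq_eq, div_le_iff₀ (side_pow_pos k)]
    calc (expect (pairIntensity (2 * k)) (ψ (2 * k))).re
        ≤ 1 / ((lvl (2 * k) : ℝ) + 1) * ((2 * k : ℕ) : ℝ) ^ 4 := le_of_lt hlt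
      _ ≤ 1 / ((n : ℝ) + 1) * ((2 * k : ℕ) : ℝ) ^ 4 := mul_le_mul_of_nonneg_right h1 hX
      _ ≤ ε * ((2 * k : ℕ) : ℝ) ^ 4 := mul_le_mul_of_nonneg_right hn.le hX
  have hle : liminf (lroSeq ψ) atTop ≤ liminf (lroSeq ψ) atTop / 2 :=
    liminf_le_of_frequently_le (hfreq _ (half_pos hLRO))
      (isBoundedUnder_of ⟨0, fun k => lroSeq_nonneg ψ k⟩)
  linarith

/-- **The summit's matrix at `(U,δ)` is the order indicator at seed `0`** (`δ ≥ −1`, i.e. whenever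
the prescribed particle number fits into the torus — always in the window). [folklore] -/
theorem summitAt_iff_orderBound_zero {U δ : ℝ} (hδ : -1 ≤ δ) : SummitAt U δ ↔ OrderBound U δ 0 :=
  ⟨orderBound_zero_of_summitAt hδ, summitAt_of_orderBound_zero⟩

/-! ## §5 Sharpest normal form: one order indicator, lit at seed `1/20` ⇒ lit at seed `0` -/

/-- **Threshold normal form.** `TwTipContinuation ⟺ ∃U₁>0 ∃δ∈[1/10,2/5] ∀U∈(0,U₁],
OrderBound U δ (1/20) → OrderBound U δ 0`: since the indicator is an up-set in the seed (§3), the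
crux says exactly that the threshold seed `g⋆(U,δ) := inf {g | OrderBound U δ g}` does not lie in
`(0, 1/20]`, at one `δ` of the window, for all small `U`. Seeds in `(0,1/20)` never enter; neither
does anything "comparable with the bare U". [folklore] -/
theorem tip_iff_threshold :
    TwTipContinuation ↔
      ∃ U₁ : ℝ, 0 < U₁ ∧ ∃ δ ∈ Set.Icc (1 / 10 : ℝ) (2 / 5), ∀ U ∈ Set.Ioc (0 : ℝ) U₁,
        OrderBound U δ (1 / 20) → OrderBound U δ 0 := by
  rw [tip_iff_fixedSeeds]
  unfold TipFixedSeeds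
  refine exists_congr fun U₁ => and_congr_right fun _ => exists_congr fun δ =>
    and_congr_right fun hδ => forall₂_congr fun U _ => ?_
  have hδ' : (-1 : ℝ) ≤ δ := by linarith [hδ.1]
  rw [rungSeeds_iff_orderBound (by norm_num), summitAt_iff_orderBound_zero hδ']

/-- **What a kill needs.** `¬ TwTipContinuation ⟺` at EVERY `δ ∈ [1/10,2/5]` and for arbitrarily
small `U > 0`: the O(1)-seeded d-wave BCS–Hubbard torus has every-GS order (lit at `1/20`) AND the
pure Hubbard torus has a ground-state branch without it (dark at `0`). Both conjuncts are open
(first: every-GS LRO with `t = 1`, `U > 0` unproved; second: negation of the Kohn–Luttinger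
consensus at `δ ≈ 0.1–0.35`). [folklore] -/
theorem not_tip_iff :
    ¬ TwTipContinuation ↔
      ∀ U₁ : ℝ, 0 < U₁ → ∀ δ ∈ Set.Icc (1 / 10 : ℝ) (2 / 5), ∃ U ∈ Set.Ioc (0 : ℝ) U₁,
        OrderBound U δ (1 / 20) ∧ ¬ OrderBound U δ 0 := by
  rw [tip_iff_threshold]
  simp only [not_exists, not_and, Classical.not_imp, not_forall]

/-- Way 1 to be TRUE: the `U`-uniform summit at one `δ` of the window (the intended reading — weak
coupling d-wave superconductivity). [folklore] -/
theorem tip_of_summitWindow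
    (h : ∃ U₁ : ℝ, 0 < U₁ ∧ ∃ δ ∈ Set.Icc (1 / 10 : ℝ) (2 / 5), ∀ U ∈ Set.Ioc (0 : ℝ) U₁,
      SummitAt U δ) :
    TwTipContinuation := by
  obtain ⟨U₁, hU₁, δ, hδ, h⟩ := h
  exact tip_iff_fixedSeeds.2 ⟨U₁, hU₁, δ, hδ, fun U hU _ => h U hU⟩

/-- Way 2 to be TRUE (vacuity hazard): FAILURE of the O(1)-seeded anchor at one `δ` of the window
for all small `U` proves the Tip — while making the thesis `X = Rung ∧ Tip` false. [folklore] -/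
theorem tip_of_anchorFailure
    (h : ∃ U₁ : ℝ, 0 < U₁ ∧ ∃ δ ∈ Set.Icc (1 / 10 : ℝ) (2 / 5), ∀ U ∈ Set.Ioc (0 : ℝ) U₁,
      ¬ OrderBound U δ (1 / 20)) :
    TwTipContinuation := by
  obtain ⟨U₁, hU₁, δ, hδ, h⟩ := h
  exact tip_iff_threshold.2 ⟨U₁, hU₁, δ, hδ, fun U hU hR => absurd hR (h U hU)⟩

/-- Negative-side tool: DARK AT ANY SEED `g ≥ 0` refutes the summit's conclusion at `(U,δ)` (every
rung of the anchor is necessary for the summit there). [folklore] -/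
theorem not_summitAt_of_not_orderBound {U δ g : ℝ} (hδ : -1 ≤ δ) (hg : 0 ≤ g)
    (h : ¬ OrderBound U δ g) : ¬ SummitAt U δ :=
  fun hS => h (orderBound_mono hg (orderBound_zero_of_summitAt hδ hS))


/-! ## §6 Load-bearing hypotheses of the crux's SHAPE (what any proof must use; vacuity hazards) -/

/-- `⟨cψ, A cψ⟩ = c̄ c ⟨ψ, A ψ⟩`. [folklore] -/
theorem expect_smul_vec {L : ℕ} (A : Matrix (Finset (Orb (FermionTorus 2 L))) (Finset (Orb (FermionTorus 2 L))) ℂ)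
    (c : ℂ) (ψ : Fock (Orb (FermionTorus 2 L))) :
    expect A (c • ψ) = starRingEnd ℂ c * c * expect A ψ := by
  simp only [Literature.MathematicalPhysics.QuantumLattice.expect, mulVec_smul, star_smul,
    smul_dotProduct, dotProduct_smul, smul_eq_mul, Complex.star_def]
  ring

/-- RUNG WITHOUT the normalisation `star ψ ⬝ᵥ ψ = 1` (ground states are only `≠ 0`). [folklore] -/
def OrderBoundNoNorm (U δ g : ℝ) : Prop :=
  ∃ c : ℝ, 0 < c ∧ ∃ L₀ : ℕ, ∀ (L : ℕ) [NeZero L], L₀ ≤ L → Even L →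
    ∀ ψ : Fock (Orb (FermionTorus 2 L)),
      IsGroundStateInSector (seededH U g L) (pairNumber δ L) 0 ψ →
        c * (L : ℝ) ^ 4 ≤ (expect (pairIntensity L) ψ).re

/-- **The normalisation clause of RUNG is load-bearing for non-vacuity**: without it the order
bound is FALSE at every `(U, δ ≥ −1, g)` (rescale a ground state towards `0`). [folklore] -/
theorem not_orderBoundNoNorm (U δ g : ℝ) (hδ : -1 ≤ δ) : ¬ OrderBoundNoNorm U δ g := by
  rintro ⟨c, hc, L₀, h⟩
  haveI : NeZero (2 * (L₀ + 1)) := ⟨by omega⟩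
  have hn : halfN δ (2 * (L₀ + 1)) ≤ Fintype.card (FermionTorus 2 (2 * (L₀ + 1))) := by
    rw [Summit.HubbardSuperconductivity.NoGo.card_fermionTorus_two]
    exact Summit.HubbardSuperconductivity.NoGo.floor_pairNumber_le δ hδ _
  obtain ⟨ψ, -, hgs⟩ := exists_unit_groundState U g (2 * (L₀ + 1)) hn
  set B := (expect (pairIntensity (2 * (L₀ + 1))) ψ).re with hB
  have hB0 : 0 ≤ B := expect_pairIntensity_nonneg _ ψ
  set X : ℝ := ((2 * (L₀ + 1) : ℕ) : ℝ) ^ 4 with hXdef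
  have hX : 0 < X := side_pow_pos (L₀ + 1)
  have hcX : 0 < c * X := mul_pos hc hX
  obtain ⟨m, hm⟩ := exists_nat_gt (B / (c * X))
  have hBlt : B < (m : ℝ) * (c * X) := (div_lt_iff₀ hcX).1 hm
  set t : ℝ := 1 / ((m : ℝ) + 1) with ht
  have ht0 : 0 < t := by positivity
  have ht1 : t ≤ 1 := by
    rw [ht, div_le_one (by positivity)]
    linarith [m.cast_nonneg (α := ℝ)]
  have htne : ((t : ℝ) : ℂ) ≠ 0 := by exact_mod_cast ht0.ne'
  have hgs' := Summit.HubbardSuperconductivity.NoGo.isGroundStateInSector_smul _ _ _ hgs htne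
  have hbound := h (2 * (L₀ + 1)) (by omega) (even_two_mul _) (((t : ℝ) : ℂ) • ψ) hgs'
  rw [expect_smul_vec] at hbound
  have hre : (starRingEnd ℂ (t : ℂ) * (t : ℂ) * expect (pairIntensity (2 * (L₀ + 1))) ψ).re
      = t ^ 2 * B := by
    rw [Complex.conj_ofReal, ← Complex.ofReal_mul, Complex.re_ofReal_mul, hB]
    ring
  rw [hre] at hbound
  have h1 : t ^ 2 * B ≤ t * B := by nlinarith
  have h2 : t * B < c * X := by
    rw [ht, one_div_mul_eq_div, div_lt_iff₀ (by positivity)]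
    nlinarith
  have h3 : c * X ≤ t ^ 2 * B := hbound
  linarith

/-- The Tip with the normalisation clause deleted from RUNG. [folklore] -/
def TipNoNormRung : Prop :=
  ∃ U₁ : ℝ, 0 < U₁ ∧ ∃ δ ∈ Set.Icc (1 / 10 : ℝ) (2 / 5), ∀ U ∈ Set.Ioc (0 : ℝ) U₁,
    ∀ K : ℝ, 0 < K → K * U ≤ 1 / 20 →
      (∀ g ∈ Set.Icc (K * U) (1 / 10), OrderBoundNoNorm U δ g) → SummitAt U δ

/-- **Vacuity hazard 1**: with the normalisation dropped from RUNG the Tip is a THEOREM (vacuous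
antecedent) — the normalisation is the only thing standing between the crux and triviality. [folklore] -/
theorem tipNoNormRung_trivial : TipNoNormRung :=
  ⟨1, one_pos, 1 / 10, ⟨le_rfl, by norm_num⟩, fun U _ K _ hKU hR =>
    absurd (hR (1 / 10) ⟨by linarith, le_rfl⟩) (not_orderBoundNoNorm U _ _ (by norm_num))⟩

/-- `Δ` kills the empty sector: for `ψ` in the `(0,0)` sector, `pairField g L ψ = 0` (grading
`(−1,−1)` of `pairField`). [folklore] -/
theorem pairField_mulVec_eq_zero_of_sector_zero (L : ℕ) [NeZero L] (g' : Site 2 → ℝ)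
    {ψ : Fock (Orb (FermionTorus 2 L))} (hψ : ψ ∈ szSector (Λ := FermionTorus 2 L) (2 * 0) (0 : ℝ)) :
    pairField g' L *ᵥ ψ = 0 := by
  have hsec := (mem_szSector_two_mul_zero_iff 0 ψ).1 hψ
  funext s
  simp only [mulVec, dotProduct, Pi.zero_apply]
  refine Finset.sum_eq_zero fun t _ => ?_
  by_cases ht : (upPart t).card = 0 ∧ (downPart t).card = 0
  · have hz : pairField g' L s t = 0 := by
      by_contra hne
      have := shifts_pairField L g' s t hne
      omega
    rw [hz, zero_mul]
  · rw [hsec t ht, mul_zero]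

/-- In the empty sector the pair intensity vanishes. [folklore] -/
theorem expect_pairIntensity_eq_zero_of_sector_zero (L : ℕ) [NeZero L]
    {ψ : Fock (Orb (FermionTorus 2 L))} (hψ : ψ ∈ szSector (Λ := FermionTorus 2 L) (2 * 0) (0 : ℝ)) :
    expect (pairIntensity L) ψ = 0 := by
  rw [PosSemidefTrace.expect_conjTranspose_mul, pairField_mulVec_eq_zero_of_sector_zero L _ hψ,
    dotProduct_zero]

/-- For `δ ≥ 1` the prescribed particle number is `0`. [folklore] -/
theorem halfN_eq_zero_of_one_le {δ : ℝ} (hδ : 1 ≤ δ) (L : ℕ) : halfN δ L = 0 := by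
  refine Nat.floor_of_nonpos ?_
  have hL : (0 : ℝ) ≤ (L : ℝ) ^ 2 := by positivity
  have : (1 - δ) * (L : ℝ) ^ 2 ≤ 0 := mul_nonpos_of_nonpos_of_nonneg (by linarith) hL
  linarith

/-- The order indicator is FALSE at every `δ ≥ 1` (the vacuum is the unique sector ground state
and carries no pairs). [folklore] -/
theorem not_orderBound_of_one_le {δ : ℝ} (hδ : 1 ≤ δ) (U g : ℝ) : ¬ OrderBound U δ g := by
  rintro ⟨c, hc, L₀, h⟩
  haveI : NeZero (2 * (L₀ + 1)) := ⟨by omega⟩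
  have h0 : pairNumber δ (2 * (L₀ + 1)) = 2 * 0 := by
    rw [pairNumber, halfN_eq_zero_of_one_le hδ]
  obtain ⟨ψ, hψ, hgs⟩ := exists_unit_groundState U g (2 * (L₀ + 1)) (n := 0) (Nat.zero_le _)
  have hb := h (2 * (L₀ + 1)) (by omega) (even_two_mul _) ψ hψ (by rw [h0]; exact hgs)
  rw [expect_pairIntensity_eq_zero_of_sector_zero _ hgs.1, Complex.zero_re] at hb
  linarith [mul_pos hc (side_pow_pos (L₀ + 1))]

/-- The Tip's SHAPE over an arbitrary doping window `W`. [folklore] -/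
def TipShape (W : Set ℝ) : Prop :=
  ∃ U₁ : ℝ, 0 < U₁ ∧ ∃ δ ∈ W, ∀ U ∈ Set.Ioc (0 : ℝ) U₁,
    ∀ K : ℝ, 0 < K → K * U ≤ 1 / 20 → RungSeeds U δ (K * U) → SummitAt U δ

/-- READBACK: the crux is `TipShape [1/10, 2/5]`. [folklore] -/
theorem tip_iff_tipShape : TwTipContinuation ↔ TipShape (Set.Icc (1 / 10) (2 / 5)) := Iff.rfl

/-- **Vacuity hazard 2 (the window is load-bearing)**: over ANY window containing a doping `δ ≥ 1`
the Tip-shape is a THEOREM (RUNG fails at the vacuum). The planner's `[1/10, 2/5]` is safe; an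
`∃ δ` ranging over `Set.Ici 0`, `Set.Icc 0 1` or `ℝ` would not be. [folklore] -/
theorem tipShape_of_one_le_mem {W : Set ℝ} {δ : ℝ} (hδ : 1 ≤ δ) (hW : δ ∈ W) : TipShape W :=
  ⟨1, one_pos, δ, hW, fun U _ K _ hKU hR =>
    absurd (hR (1 / 10) ⟨by linarith, le_rfl⟩) (not_orderBound_of_one_le hδ U _)⟩

/-- Not load-bearing: the sign condition `0 < K` — the Tip with `0 ≤ K` is equivalent (at `K = 0`
RUNG covers the seed `0` itself, which IS the conclusion by §4). [folklore] -/
theorem tip_iff_nonnegK :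
    TwTipContinuation ↔
      ∃ U₁ : ℝ, 0 < U₁ ∧ ∃ δ ∈ Set.Icc (1 / 10 : ℝ) (2 / 5), ∀ U ∈ Set.Ioc (0 : ℝ) U₁,
        ∀ K : ℝ, 0 ≤ K → K * U ≤ 1 / 20 → RungSeeds U δ (K * U) → SummitAt U δ := by
  rw [tip_iff]
  refine exists_congr fun U₁ => and_congr_right fun _ => exists_congr fun δ =>
    and_congr_right fun hδ => forall₂_congr fun U hU => ⟨fun h K hK hKU hR => ?_, fun h K hK => h K hK.le⟩
  have hδ' : (-1 : ℝ) ≤ δ := by linarith [hδ.1]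
  rcases eq_or_lt_of_le hK with rfl | hKpos
  · rw [zero_mul] at hR
    exact summitAt_of_orderBound_zero (hR 0 ⟨le_rfl, by norm_num⟩)
  · exact h K hKpos hKU hR

/-! ## §7 (gen 2, new) CHORDS: the order at a seed is pinned between LEFT and RIGHT difference
quotients of the concave sector-energy profile `g ↦ E_L(g)`; at the corner `g = 0` the only left
chords sit at NEGATIVE seeds (pair SUPPRESSION) -/

/-- The sector ground-state energy `E_L(U,g;n) = minEnergyOn (H_L(U,g)) (szSector 2n 0)`. [folklore] -/
abbrev sectorEnergy (U g : ℝ) (L : ℕ) [NeZero L] (n : ℕ) : ℝ :=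
  (seededH U g L).minEnergyOn (szSector (2 * n) 0)

/-- **Left chord ≤ order** (the RUNG chord): for `g' < g` and every normalised sector GS `ψ` of
`H_L(U,g)`, `E_L(g') − E_L(g) ≤ ((g − g')/L²)·re⟨ψ,P_Lψ⟩`. [folklore] -/
theorem leftChord_le_order {U g g' : ℝ} {L : ℕ} [NeZero L] {n : ℕ} (hg : g' < g)
    {ψ : Fock (Orb (FermionTorus 2 L))} (hψ : star ψ ⬝ᵥ ψ = 1)
    (hgs : IsGroundStateInSector (seededH U g L) (2 * n) 0 ψ) :
    sectorEnergy U g' L n - sectorEnergy U g L n ≤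
      (g - g') / (L : ℝ) ^ 2 * (expect (pairIntensity L) ψ).re := by
  have hn := le_card_of_mem_szSector L hgs.1 hgs.2.1
  obtain ⟨-, hb⟩ := seeded_sector_groundState U g' L hn
  have v : sectorEnergy U g' L n ≤ (expect (seededH U g' L) ψ).re := hb ψ hgs.1 hψ
  have e : (expect (seededH U g L) ψ).re = sectorEnergy U g L n := by
    rw [expect_eq_of_groundState L hψ hgs, Complex.ofReal_re]
  have r := expect_seededH_re U g L g' ψ
  have _unused := hg
  have : (g - g') / (L : ℝ) ^ 2 * (expect (pairIntensity L) ψ).re =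
      -((g' - g) / (L : ℝ) ^ 2 * (expect (pairIntensity L) ψ).re) := by ring
  linarith

/-- **Order ≤ right chord** (the CEILING chord): for `g < g''` and every normalised sector GS `ψ`
of `H_L(U,g)`, `((g'' − g)/L²)·re⟨ψ,P_Lψ⟩ ≤ E_L(g) − E_L(g'')`. [folklore] -/
theorem order_le_rightChord {U g g'' : ℝ} {L : ℕ} [NeZero L] {n : ℕ} (hg : g < g'')
    {ψ : Fock (Orb (FermionTorus 2 L))} (hψ : star ψ ⬝ᵥ ψ = 1)
    (hgs : IsGroundStateInSector (seededH U g L) (2 * n) 0 ψ) :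
    (g'' - g) / (L : ℝ) ^ 2 * (expect (pairIntensity L) ψ).re ≤
      sectorEnergy U g L n - sectorEnergy U g'' L n := by
  have hn := le_card_of_mem_szSector L hgs.1 hgs.2.1
  obtain ⟨-, hb⟩ := seeded_sector_groundState U g'' L hn
  have v : sectorEnergy U g'' L n ≤ (expect (seededH U g'' L) ψ).re := hb ψ hgs.1 hψ
  have e : (expect (seededH U g L) ψ).re = sectorEnergy U g L n := by
    rw [expect_eq_of_groundState L hψ hgs, Complex.ofReal_re]
  have r := expect_seededH_re U g L g'' ψ
  have _unused := hg
  linarith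

/-- `g ↦ E_L(g)` is non-increasing (`P_L ≥ 0`). [folklore] -/
theorem sectorEnergy_antitone {U : ℝ} {L : ℕ} [NeZero L] {n : ℕ} (hn : n ≤ Fintype.card (FermionTorus 2 L))
    {g g'' : ℝ} (hg : g ≤ g'') : sectorEnergy U g'' L n ≤ sectorEnergy U g L n := by
  rcases eq_or_lt_of_le hg with rfl | hlt
  · exact le_rfl
  obtain ⟨ψ, hψ, hgs⟩ := exists_unit_groundState U g L hn
  have h := order_le_rightChord hlt hψ hgs
  have hL : (0 : ℝ) < (L : ℝ) ^ 2 := by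
    have := NeZero.pos L
    positivity
  have : 0 ≤ (g'' - g) / (L : ℝ) ^ 2 * (expect (pairIntensity L) ψ).re :=
    mul_nonneg (div_nonneg (sub_nonneg.2 hg) hL.le) (expect_pairIntensity_nonneg L ψ)
  linarith

/-- `g ↦ E_L(g)` is midpoint-concave along chords: for `g' < g < g''`,
`(E(g') − E(g))/(g − g') ≤ (E(g) − E(g''))/(g'' − g)` (both pinch the order at `g`). [folklore] -/
theorem chord_slope_mono {U g' g g'' : ℝ} {L : ℕ} [NeZero L] {n : ℕ}
    (hn : n ≤ Fintype.card (FermionTorus 2 L)) (h₁ : g' < g) (h₂ : g < g'') :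
    (sectorEnergy U g' L n - sectorEnergy U g L n) / (g - g') ≤
      (sectorEnergy U g L n - sectorEnergy U g'' L n) / (g'' - g) := by
  obtain ⟨ψ, hψ, hgs⟩ := exists_unit_groundState U g L hn
  have hl := leftChord_le_order h₁ hψ hgs
  have hr := order_le_rightChord h₂ hψ hgs
  have hL : (0 : ℝ) < (L : ℝ) ^ 2 := by
    have := NeZero.pos L
    positivity
  set P := (expect (pairIntensity L) ψ).re
  have hP : (sectorEnergy U g' L n - sectorEnergy U g L n) / (g - g') ≤ P / (L : ℝ) ^ 2 := by
    rw [div_le_iff₀ (sub_pos.2 h₁)]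
    calc sectorEnergy U g' L n - sectorEnergy U g L n ≤ (g - g') / (L : ℝ) ^ 2 * P := hl
      _ = P / (L : ℝ) ^ 2 * (g - g') := by ring
  have hQ : P / (L : ℝ) ^ 2 ≤ (sectorEnergy U g L n - sectorEnergy U g'' L n) / (g'' - g) := by
    rw [le_div_iff₀ (sub_pos.2 h₂)]
    calc P / (L : ℝ) ^ 2 * (g'' - g) = (g'' - g) / (L : ℝ) ^ 2 * P := by ring
      _ ≤ sectorEnergy U g L n - sectorEnergy U g'' L n := hr
  exact hP.trans hQ

/-- **Corner tool (positive side): linear cost of pair SUPPRESSION ⇒ every-GS order at seed 0.**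
If eventually (even `L`) some repulsive d-wave pair term `+(η/L²)P_L`, `η = η_L > 0`, raises the sector
energy by at least `c·η·L²`, then `OrderBound U δ 0` (hence the summit at `(U,δ)`, §4). This is the
ONLY direction in which energies bound the corner order from below: left chords at `g = 0` live at
negative seeds. [folklore] -/
theorem orderBound_zero_of_suppressionCost {U δ : ℝ}
    (h : ∃ c : ℝ, 0 < c ∧ ∃ L₀ : ℕ, ∀ (L : ℕ) [NeZero L], L₀ ≤ L → Even L →
      ∃ η : ℝ, 0 < η ∧ c * η * (L : ℝ) ^ 2 ≤
        sectorEnergy U (-η) L (halfN δ L) - sectorEnergy U 0 L (halfN δ L)) :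
    OrderBound U δ 0 := by
  obtain ⟨c, hc, L₀, h⟩ := h
  refine ⟨c, hc, L₀, fun L _ hL₀ hE ψ hψ hgs => ?_⟩
  obtain ⟨η, hη, hcost⟩ := h L hL₀ hE
  have hl := leftChord_le_order (U := U) (g := 0) (g' := -η) (by linarith) hψ hgs
  have hL : (0 : ℝ) < (L : ℝ) ^ 2 := by
    have := NeZero.pos L
    positivity
  rw [sub_neg_eq_add, zero_add] at hl
  -- c η L² ≤ (η/L²) P  ⇒  c L⁴ ≤ P
  have key : c * η * (L : ℝ) ^ 2 ≤ η / (L : ℝ) ^ 2 * (expect (pairIntensity L) ψ).re :=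
    hcost.trans hl
  rw [div_mul_eq_mul_div, le_div_iff₀ hL] at key
  have : η * (c * (L : ℝ) ^ 4) ≤ η * (expect (pairIntensity L) ψ).re := by nlinarith
  exact le_of_mul_le_mul_left this hη

/-- **Every-GS order forces a LINEAR energy gain from any further attraction**: `OrderBound U δ g₀`
with constant `c` gives `c (g'' − g₀) L² ≤ E_L(g₀) − E_L(g'')` for all `g'' > g₀`, eventually in even
`L`. [folklore] -/
theorem linearGain_of_orderBound {U δ g₀ : ℝ} (hδ : -1 ≤ δ) (h : OrderBound U δ g₀) :
    ∃ c : ℝ, 0 < c ∧ ∃ L₀ : ℕ, ∀ (L : ℕ) [NeZero L], L₀ ≤ L → Even L → ∀ g'' : ℝ, g₀ < g'' →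
      c * (g'' - g₀) * (L : ℝ) ^ 2 ≤
        sectorEnergy U g₀ L (halfN δ L) - sectorEnergy U g'' L (halfN δ L) := by
  obtain ⟨c, hc, L₀, h⟩ := h
  refine ⟨c, hc, L₀, fun L _ hL₀ hE g'' hg => ?_⟩
  have hn : halfN δ L ≤ Fintype.card (FermionTorus 2 L) := by
    rw [Summit.HubbardSuperconductivity.NoGo.card_fermionTorus_two]
    exact Summit.HubbardSuperconductivity.NoGo.floor_pairNumber_le δ hδ L
  obtain ⟨ψ, hψ, hgs⟩ := exists_unit_groundState U g₀ L hn
  have hb := h L hL₀ hE ψ hψ hgs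
  have hr := order_le_rightChord hg hψ hgs
  have hL : (0 : ℝ) < (L : ℝ) ^ 2 := by
    have := NeZero.pos L
    positivity
  have : (g'' - g₀) / (L : ℝ) ^ 2 * (c * (L : ℝ) ^ 4) ≤
      (g'' - g₀) / (L : ℝ) ^ 2 * (expect (pairIntensity L) ψ).re :=
    mul_le_mul_of_nonneg_left hb (div_nonneg (sub_pos.2 hg).le hL.le)
  have hid : (g'' - g₀) / (L : ℝ) ^ 2 * (c * (L : ℝ) ^ 4) = c * (g'' - g₀) * (L : ℝ) ^ 2 := by
    field_simp
  linarith

/-- **Corner tool (negative side, the route's own CEILING mechanism made a refutation device):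
SUBLINEAR energy gain from a small attractive seed, frequently in even `L`, refutes the order
indicator at `g₀`** — and at `g₀ = 0` the summit at `(U,δ)` (`not_summitAt_of_sublinearGain`). [folklore] -/
theorem not_orderBound_of_sublinearGain {U δ g₀ : ℝ} (hδ : -1 ≤ δ)
    (h : ∀ c : ℝ, 0 < c → ∀ L₀ : ℕ, ∃ (L : ℕ) (_ : NeZero L), L₀ ≤ L ∧ Even L ∧ ∃ g'' : ℝ, g₀ < g'' ∧
      sectorEnergy U g₀ L (halfN δ L) - sectorEnergy U g'' L (halfN δ L) <
        c * (g'' - g₀) * (L : ℝ) ^ 2) :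
    ¬ OrderBound U δ g₀ := by
  intro hOB
  obtain ⟨c, hc, L₀, hlin⟩ := linearGain_of_orderBound hδ hOB
  obtain ⟨L, _, hL₀, hE, g'', hg, hlt⟩ := h c hc L₀
  have := hlin L hL₀ hE g'' hg
  linarith

/-- At the corner: sublinear gain from small attractive d-wave seeds (frequently in even `L`)
refutes the summit's conclusion at `(U,δ)`. [folklore] -/
theorem not_summitAt_of_sublinearGain {U δ : ℝ} (hδ : -1 ≤ δ)
    (h : ∀ c : ℝ, 0 < c → ∀ L₀ : ℕ, ∃ (L : ℕ) (_ : NeZero L), L₀ ≤ L ∧ Even L ∧ ∃ g'' : ℝ, 0 < g'' ∧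
      sectorEnergy U 0 L (halfN δ L) - sectorEnergy U g'' L (halfN δ L) <
        c * (g'' - 0) * (L : ℝ) ^ 2) :
    ¬ SummitAt U δ :=
  fun hS => not_orderBound_of_sublinearGain hδ h (orderBound_zero_of_summitAt hδ hS)


/-! ## §8 (gen 2, new) The Tip-SHAPE is false for abstract seeded families: a two-level witness with a
level crossing at `g = 1/40` (so the crux, if true, is true for MODEL-SPECIFIC reasons only) -/

/-- Toy ground states: unit minimisers of the quadratic form of a real `2 × 2` matrix. [folklore] -/
def IsToyGS (M : Matrix (Fin 2) (Fin 2) ℝ) (v : Fin 2 → ℝ) : Prop :=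
  v ⬝ᵥ v = 1 ∧ ∀ w : Fin 2 → ℝ, w ⬝ᵥ w = 1 → v ⬝ᵥ M *ᵥ v ≤ w ⬝ᵥ M *ᵥ w

/-- Toy "kinetic" part `A = diag(0, 1)`. [folklore] -/
def toyA : Matrix (Fin 2) (Fin 2) ℝ := Matrix.diagonal ![0, 1]

/-- Toy "pair intensity" `P = diag(0, 40) ≥ 0`. [folklore] -/
def toyP : Matrix (Fin 2) (Fin 2) ℝ := Matrix.diagonal ![0, 40]

/-- `⟨v, (A − gP) v⟩ = (1 − 40g) v₁²`. [folklore] -/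
theorem toy_form (g : ℝ) (v : Fin 2 → ℝ) :
    v ⬝ᵥ (toyA - g • toyP) *ᵥ v = (1 - 40 * g) * v 1 ^ 2 := by
  simp [toyA, toyP, Matrix.mulVec, dotProduct, Fin.sum_univ_two, Matrix.diagonal,
    Matrix.sub_apply]
  ring

/-- `⟨v, P v⟩ = 40 v₁²`. [folklore] -/
theorem toy_formP (v : Fin 2 → ℝ) : v ⬝ᵥ toyP *ᵥ v = 40 * v 1 ^ 2 := by
  simp [toyP, Matrix.mulVec, dotProduct, Fin.sum_univ_two, Matrix.diagonal]
  ring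

/-- `⟨v, A v⟩ = v₁²`. [folklore] -/
theorem toy_formA (v : Fin 2 → ℝ) : v ⬝ᵥ toyA *ᵥ v = v 1 ^ 2 := by
  simp [toyA, Matrix.mulVec, dotProduct, Fin.sum_univ_two, Matrix.diagonal]
  ring

/-- `‖v‖² = v₀² + v₁²`. [folklore] -/
theorem toy_norm (v : Fin 2 → ℝ) : v ⬝ᵥ v = v 0 ^ 2 + v 1 ^ 2 := by
  simp [dotProduct, Fin.sum_univ_two]
  ring

/-- `P ≥ 0`. [folklore] -/
theorem toyP_posSemidef : toyP.PosSemidef :=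
  Matrix.PosSemidef.diagonal (by intro i; fin_cases i <;> simp)

/-- LIT at seed `1/20`: every toy ground state of `A − P/20 = diag(0, −1)` has `⟨P⟩ = 40 ≥ 1`. [folklore] -/
theorem toy_lit (v : Fin 2 → ℝ) (hv : IsToyGS (toyA - (1 / 20 : ℝ) • toyP) v) :
    1 ≤ v ⬝ᵥ toyP *ᵥ v := by
  obtain ⟨hn, hmin⟩ := hv
  have h := hmin ![0, 1] (by simp [dotProduct, Fin.sum_univ_two])
  rw [toy_form, toy_form] at h
  rw [toy_norm] at hn
  rw [toy_formP]
  simp at h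
  nlinarith

/-- DARK at seed `0`: `e₀` is a toy ground state of `A` with `⟨P⟩ = 0`. [folklore] -/
theorem toy_dark : ∃ v : Fin 2 → ℝ, IsToyGS toyA v ∧ v ⬝ᵥ toyP *ᵥ v = 0 := by
  refine ⟨![1, 0], ⟨by simp [dotProduct, Fin.sum_univ_two], fun w _ => ?_⟩, by rw [toy_formP]; simp⟩
  rw [toy_formA, toy_formA]
  simp
  positivity

/-- **The abstract Tip-shape is FALSE.** It is NOT true that for every symmetric `A` and every
`P ≥ 0` (seeded family `A − gP`, the order `⟨P⟩` an up-set in `g` exactly as in §3), every-GS order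
`⟨P⟩ ≥ 1` at seed `1/20` forces every-GS order `⟨P⟩ > 0` at seed `0`: the two-level family
`diag(0, 1 − 40g)` is lit for `g > 1/40` and dark for `g < 1/40` (first-order level crossing inside
`(0, 1/20)`). In the many-body problem this is the scenario "a competing state wins at `g = 0`";
nothing in the crux's hypotheses excludes it, so any proof of the Tip must use properties of
`hubbardTorus` beyond hermiticity, `P_L ≥ 0` and linearity in the seed. [folklore] -/
theorem not_abstract_tipShape :
    ¬ (∀ (A P : Matrix (Fin 2) (Fin 2) ℝ), P.PosSemidef →
        (∀ v, IsToyGS (A - (1 / 20 : ℝ) • P) v → 1 ≤ v ⬝ᵥ P *ᵥ v) →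
          ∀ v, IsToyGS A v → 0 < v ⬝ᵥ P *ᵥ v) := by
  intro h
  obtain ⟨v, hv, hP⟩ := toy_dark
  have := h toyA toyP toyP_posSemidef toy_lit v hv
  rw [hP] at this
  exact lt_irrefl _ this


/-! ## §9 The reviewers' re-signature ("continuation ALONG the wedge") in normal form -/

/-- The route reviewers' proposed repair (refuter notes on stmt-1700, 2026-08-15 11:17Z / 13:00Z):
quantify the continuation along the wedge, `∃δ ∀K>0 ∃U₁>0 ∀U∈(0,U₁], K·U ≤ 1/20 → RUNG(U,δ,K) →
Concl(U,δ)` (Assembly adapts: `U := min U₀ (U₁ K)`). [folklore] -/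
def TipAlongWedge : Prop :=
  ∃ δ ∈ Set.Icc (1 / 10 : ℝ) (2 / 5), ∀ K : ℝ, 0 < K → ∃ U₁ : ℝ, 0 < U₁ ∧ ∀ U ∈ Set.Ioc (0 : ℝ) U₁,
    K * U ≤ 1 / 20 → RungSeeds U δ (K * U) → SummitAt U δ

/-- The typed Tip implies the re-signature (which is therefore WEAKER — still a bet). [folklore] -/
theorem tipAlongWedge_of_tip (h : TwTipContinuation) : TipAlongWedge := by
  obtain ⟨U₁, hU₁, δ, hδ, h⟩ := tip_iff.1 h
  exact ⟨δ, hδ, fun K hK => ⟨U₁, hU₁, fun U hU hKU hR => h U hU K hK hKU hR⟩⟩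

/-- **Normal form of the re-signature**: `TipAlongWedge ⟺ ∃δ ∀K>0 ∃U₁>0 ∀U∈(0,U₁], K·U ≤ 1/20 →
OrderBound U δ (K·U) → OrderBound U δ 0` — for every slope `K`, eventually in `U`, lit at the seed
`K·U` forces lit at `0`: the threshold seed satisfies `g⋆(U,δ) ∉ (0, K·U]` for `U ≤ U₁(K)`, i.e.
"`g⋆(U,δ) = 0` or `g⋆(U,δ)/U → ∞` is excluded slope by slope". Same vacuity shape as the Tip
(`tipAlongWedge_of_anchorFailure`). [folklore] -/
theorem tipAlongWedge_iff_threshold :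
    TipAlongWedge ↔
      ∃ δ ∈ Set.Icc (1 / 10 : ℝ) (2 / 5), ∀ K : ℝ, 0 < K → ∃ U₁ : ℝ, 0 < U₁ ∧ ∀ U ∈ Set.Ioc (0 : ℝ) U₁,
        K * U ≤ 1 / 20 → OrderBound U δ (K * U) → OrderBound U δ 0 := by
  unfold TipAlongWedge
  refine exists_congr fun δ => and_congr_right fun hδ => forall₂_congr fun K _ =>
    exists_congr fun U₁ => and_congr_right fun _ => forall₂_congr fun U _ => forall_congr' fun hKU => ?_
  have hδ' : (-1 : ℝ) ≤ δ := by linarith [hδ.1]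
  rw [rungSeeds_iff_orderBound (by linarith), summitAt_iff_orderBound_zero hδ']

/-- The re-signature inherits vacuity-by-anchor-failure: if for one `δ` of the window and EVERY slope
`K` the rung at seed `K·U` fails for all small `U`, `TipAlongWedge` holds. [folklore] -/
theorem tipAlongWedge_of_anchorFailure
    (h : ∃ δ ∈ Set.Icc (1 / 10 : ℝ) (2 / 5), ∀ K : ℝ, 0 < K → ∃ U₁ : ℝ, 0 < U₁ ∧
      ∀ U ∈ Set.Ioc (0 : ℝ) U₁, ¬ OrderBound U δ (K * U)) :
    TipAlongWedge := by
  obtain ⟨δ, hδ, h⟩ := h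
  refine tipAlongWedge_iff_threshold.2 ⟨δ, hδ, fun K hK => ?_⟩
  obtain ⟨U₁, hU₁, hno⟩ := h K hK
  exact ⟨U₁, hU₁, fun U hU _ hR => absurd hR (hno U hU)⟩

/-- … and it still follows from the `U`-uniform summit at one `δ` (intended reading). [folklore] -/
theorem tipAlongWedge_of_summitWindow
    (h : ∃ U₁ : ℝ, 0 < U₁ ∧ ∃ δ ∈ Set.Icc (1 / 10 : ℝ) (2 / 5), ∀ U ∈ Set.Ioc (0 : ℝ) U₁,
      SummitAt U δ) :
    TipAlongWedge :=
  tipAlongWedge_of_tip (tip_of_summitWindow h)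


/-! ## §10 (gen 2, new) Planner-side logic: the order "`∃δ` BEFORE `∀U`" is load-bearing for the Assembly -/

/-- **Abstract independence.** With UNINTERPRETED predicates `R U δ` (rung) and `S U δ` (summit matrix),
the anchor-shape `∀δ∈W ∃U₀>0 ∀U∈(0,U₀], R U δ` together with the WEAKENED tip-shape
`∃U₁>0 ∀U∈(0,U₁] ∃δ∈W, R U δ → S U δ` (doping chosen AFTER `U`) does NOT yield `∃U>0 ∃δ∈W, S U δ`:
witness `R U δ := U < h δ` with `h (1/10) = 1`, `h δ = (δ − 1/10)/2` otherwise (positive on the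
window, infimum `0`), `S := False`. So a planner re-signing the Tip must keep `∃δ` (or a `U`-uniform
`δ`) in front of `∀U`, as the typed crux does. [folklore] -/
theorem weakTip_does_not_assemble :
    ¬ (∀ (R S : ℝ → ℝ → Prop),
        (∀ δ ∈ Set.Icc (1 / 10 : ℝ) (2 / 5), ∃ U₀ : ℝ, 0 < U₀ ∧ ∀ U ∈ Set.Ioc (0 : ℝ) U₀, R U δ) →
        (∃ U₁ : ℝ, 0 < U₁ ∧ ∀ U ∈ Set.Ioc (0 : ℝ) U₁,
            ∃ δ ∈ Set.Icc (1 / 10 : ℝ) (2 / 5), R U δ → S U δ) →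
          ∃ U : ℝ, 0 < U ∧ ∃ δ ∈ Set.Icc (1 / 10 : ℝ) (2 / 5), S U δ) := by
  intro h
  -- the witness threshold function
  let hgt : ℝ → ℝ := fun δ => if δ = 1 / 10 then 1 else (δ - 1 / 10) / 2
  have hgt_pos : ∀ δ ∈ Set.Icc (1 / 10 : ℝ) (2 / 5), 0 < hgt δ := by
    intro δ hδ
    simp only [hgt]
    split_ifs with h0
    · norm_num
    · have : 1 / 10 < δ := lt_of_le_of_ne hδ.1 (Ne.symm h0)
      linarith
  have hA : ∀ δ ∈ Set.Icc (1 / 10 : ℝ) (2 / 5), ∃ U₀ : ℝ, 0 < U₀ ∧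
      ∀ U ∈ Set.Ioc (0 : ℝ) U₀, U < hgt δ := by
    intro δ hδ
    refine ⟨hgt δ / 2, by linarith [hgt_pos δ hδ], fun U hU => ?_⟩
    linarith [hU.2, hgt_pos δ hδ]
  have hT : ∃ U₁ : ℝ, 0 < U₁ ∧ ∀ U ∈ Set.Ioc (0 : ℝ) U₁,
      ∃ δ ∈ Set.Icc (1 / 10 : ℝ) (2 / 5), U < hgt δ → False := by
    refine ⟨1 / 10, by norm_num, fun U hU => ⟨1 / 10 + U, ⟨by linarith [hU.1], by linarith [hU.2]⟩,
      fun hR => ?_⟩⟩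
    have hne : (1 / 10 + U : ℝ) ≠ 1 / 10 := by linarith [hU.1]
    have hR' : U < (1 / 10 + U - 1 / 10) / 2 := by
      have := hR
      simp only [hgt, if_neg hne] at this
      exact this
    linarith [hU.1]
  obtain ⟨U, -, δ, -, hS⟩ := h (fun U δ => U < hgt δ) (fun _ _ => False) hA hT
  exact hS


/-! ## §11 (gen 3, new) Under the anchor the Tip IS the `U`-uniform summit at one `δ`; the thesis
`X = Rung ∧ Tip` is `Rung ∧ SummitWindow` -/

/-- The `U`-UNIFORM summit at one doping of the window: `∃U₁>0 ∃δ∈[1/10,2/5] ∀U∈(0,U₁], SummitAt U δ`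
(strictly stronger than the summit `∃U>0 ∃δ∈(0,1/2), SummitAt U δ`). [folklore] -/
def SummitWindow : Prop :=
  ∃ U₁ : ℝ, 0 < U₁ ∧ ∃ δ ∈ Set.Icc (1 / 10 : ℝ) (2 / 5), ∀ U ∈ Set.Ioc (0 : ℝ) U₁, SummitAt U δ

/-- READBACK (`Iff.rfl`) of the anchor `TwSeededRung` in the vocabulary of §0. [folklore] -/
theorem rung_iff :
    TwSeededRung ↔
      ∀ δ ∈ Set.Icc (1 / 10 : ℝ) (2 / 5), ∃ U₀ K : ℝ, 0 < U₀ ∧ 0 < K ∧ K * U₀ ≤ 1 / 20 ∧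
        ∀ U ∈ Set.Ioc (0 : ℝ) U₀, RungSeeds U δ (K * U) :=
  Iff.rfl

/-- **Under the anchor, the Tip is EXACTLY the `U`-uniform summit at one `δ` of the window.**
(`→`: at the Tip's `δ` the anchor supplies `RungSeeds U δ (K·U)` for `U ≤ min U₀ U₁`, which the Tip
turns into `SummitAt U δ`; `←`: `tip_of_summitWindow`, the rung hypothesis is discarded.) So inside the
thesis `X = TwSeededRung ∧ TwTipContinuation` the crux carries no information beyond `SummitWindow`:
the anchor is used only to discharge the Tip's own antecedent. [folklore] -/
theorem tip_iff_summitWindow_of_rung (hR : TwSeededRung) : TwTipContinuation ↔ SummitWindow := by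
  constructor
  · intro hT
    obtain ⟨U₁, hU₁, δ, hδ, h⟩ := tip_iff.1 hT
    obtain ⟨U₀, K, hU₀, hK, hKU₀, hRung⟩ := rung_iff.1 hR δ hδ
    refine ⟨min U₀ U₁, lt_min hU₀ hU₁, δ, hδ, fun U hU => ?_⟩
    have hU0 : U ∈ Set.Ioc (0 : ℝ) U₀ := ⟨hU.1, hU.2.trans (min_le_left _ _)⟩
    have hU1 : U ∈ Set.Ioc (0 : ℝ) U₁ := ⟨hU.1, hU.2.trans (min_le_right _ _)⟩
    have hKU : K * U ≤ 1 / 20 := le_trans (mul_le_mul_of_nonneg_left hU0.2 hK.le) hKU₀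
    exact h U hU1 K hK hKU (hRung U hU0)
  · exact tip_of_summitWindow

/-- **The thesis in normal form**: `TwSeededRung ∧ TwTipContinuation ⟺ TwSeededRung ∧ SummitWindow`. [folklore] -/
theorem thesis_iff_rung_and_summitWindow :
    (TwSeededRung ∧ TwTipContinuation) ↔ (TwSeededRung ∧ SummitWindow) :=
  ⟨fun h => ⟨h.1, (tip_iff_summitWindow_of_rung h.1).1 h.2⟩, fun h => ⟨h.1, tip_of_summitWindow h.2⟩⟩

/-- … and `SummitWindow` alone already gives the summit (the anchor is not on the path). [folklore] -/
theorem summit_of_summitWindow (h : SummitWindow) : HubbardSuperconductivity := by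
  obtain ⟨U₁, hU₁, δ, hδ, h⟩ := h
  have hδ' : δ ∈ Set.Ioo (0 : ℝ) (1 / 2) := ⟨by linarith [hδ.1], by linarith [hδ.2]⟩
  exact summit_iff.2 ⟨U₁, hU₁, δ, hδ', h U₁ ⟨hU₁, le_rfl⟩⟩

/-- `SummitWindow` in order-indicator form: `∃U₁>0 ∃δ∈[1/10,2/5] ∀U∈(0,U₁], OrderBound U δ 0` — the
every-GS d-wave order bound of the PURE torus, `U`-pointwise constants, at one `U`-uniform doping. This
is the irreducible content of the crux (and of every line attacking it). [folklore] -/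
theorem summitWindow_iff_orderBoundWindow :
    SummitWindow ↔
      ∃ U₁ : ℝ, 0 < U₁ ∧ ∃ δ ∈ Set.Icc (1 / 10 : ℝ) (2 / 5), ∀ U ∈ Set.Ioc (0 : ℝ) U₁, OrderBound U δ 0 := by
  unfold SummitWindow
  refine exists_congr fun U₁ => and_congr_right fun _ => exists_congr fun δ =>
    and_congr_right fun hδ => forall₂_congr fun U _ => ?_
  have hδ' : (-1 : ℝ) ≤ δ := by linarith [hδ.1]
  exact summitAt_iff_orderBound_zero hδ'


/-! ## §12 (gen 3, new) Load-bearing structure of the MOMENTS endgame (line `ground-space-second-moment`):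
both the spread clause (T2) and the degeneracy bound (T3) are necessary — abstract witnesses -/

/-- **T2 (spread) is load-bearing**: a ground multiplet of dimension `2` (so any degeneracy bound `D ≥ 2`
holds) with AVERAGE order `1` can contain a DARK state: order values `(2, 0)`. Hence "average order +
bounded degeneracy ⇒ every-GS order" is false without a variance clause. [folklore] -/
theorem not_pinning_without_spread :
    ¬ (∀ (y : Fin 2 → ℝ), (1 : ℝ) ≤ (∑ i, y i) / 2 → ∀ i, 0 < y i) := by
  intro h
  have := h ![2, 0] (by simp [Fin.sum_univ_two]) 1
  simp at this

/-- **T3 (bounded degeneracy) is load-bearing**: for every variance budget `ε > 0` there is a multiplet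
(dimension `d` with `1/(d−1) ≤ ε`… here simply `d = m + 2` large) with average order EXACTLY `1`,
normalised spread `d⁻¹ Σ (yᵢ − 1)² ≤ ε`, and a DARK state: values `(0, d/(d−1), …, d/(d−1))`, whose
spread is `1/(d−1)`. Hence "average + small spread ⇒ every-GS order" is false without a bound on the
degeneracy: the product `D·ε` (as in `forall_unit_le_re_of_moments`, `ε D ≤ 1/4`) is the right currency. [folklore] -/
theorem not_pinning_without_degeneracyBound :
    ¬ (∃ ε : ℝ, 0 < ε ∧ ∀ (d : ℕ) (y : Fin d → ℝ), 2 ≤ d →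
        (∑ i, y i) / d = 1 → (∑ i, (y i - 1) ^ 2) / d ≤ ε → ∀ i, 0 < y i) := by
  rintro ⟨ε, hε, h⟩
  -- choose d = m + 2 with 1/(m+1) ≤ ε
  obtain ⟨m, hm⟩ := exists_nat_one_div_lt hε
  set d : ℕ := m + 2 with hd
  have hd2 : 2 ≤ d := by omega
  have hdpos : (0 : ℝ) < d := by positivity
  have hd1 : (1 : ℝ) < d := by exact_mod_cast (show 1 < d by omega)
  -- the witness: y 0 = 0, y i = d/(d-1) otherwise
  let y : Fin d → ℝ := fun i => if i = ⟨0, by omega⟩ then 0 else (d : ℝ) / ((d : ℝ) - 1)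
  have hsum : ∑ i, y i = (d : ℝ) := by
    rw [Finset.sum_ite, Finset.sum_const_zero, zero_add, Finset.sum_const, nsmul_eq_mul]
    have hcard : ((Finset.univ.filter fun i : Fin d => ¬ i = ⟨0, by omega⟩).card : ℝ) = (d : ℝ) - 1 := by
      rw [Finset.filter_not, Finset.card_sdiff_of_subset (Finset.filter_subset _ _), Finset.card_univ,
        Fintype.card_fin]
      have h1 : (Finset.univ.filter fun i : Fin d => i = ⟨0, by omega⟩).card = 1 := by
        rw [Finset.card_eq_one]
        exact ⟨⟨0, by omega⟩, by ext i; simp⟩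
      rw [h1]
      push_cast [show 1 ≤ d by omega]
      ring
    have hne : (d : ℝ) - 1 ≠ 0 := by linarith
    rw [hcard, mul_div_assoc', div_eq_iff hne]
    ring
  have hvar : ∑ i, (y i - 1) ^ 2 = (d : ℝ) / ((d : ℝ) - 1) := by
    have hsplit : ∀ i : Fin d, (y i - 1) ^ 2 = if i = ⟨0, by omega⟩ then 1 else (1 / ((d : ℝ) - 1)) ^ 2 := by
      intro i
      simp only [y]
      split_ifs with hi
      · norm_num
      · have hne : (d : ℝ) - 1 ≠ 0 := by linarith
        field_simp
        ring
    simp only [hsplit]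
    rw [Finset.sum_ite, Finset.sum_const, Finset.sum_const, nsmul_eq_mul, nsmul_eq_mul]
    have h1 : ((Finset.univ.filter fun i : Fin d => i = ⟨0, by omega⟩).card : ℝ) = 1 := by
      have : (Finset.univ.filter fun i : Fin d => i = ⟨0, by omega⟩).card = 1 := by
        rw [Finset.card_eq_one]
        exact ⟨⟨0, by omega⟩, by ext i; simp⟩
      exact_mod_cast this
    have hcard : ((Finset.univ.filter fun i : Fin d => ¬ i = ⟨0, by omega⟩).card : ℝ) = (d : ℝ) - 1 := by
      rw [Finset.filter_not, Finset.card_sdiff_of_subset (Finset.filter_subset _ _), Finset.card_univ,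
        Fintype.card_fin]
      have h1' : (Finset.univ.filter fun i : Fin d => i = ⟨0, by omega⟩).card = 1 := by
        rw [Finset.card_eq_one]
        exact ⟨⟨0, by omega⟩, by ext i; simp⟩
      rw [h1']
      push_cast [show 1 ≤ d by omega]
      ring
    rw [h1, hcard]
    have hne : (d : ℝ) - 1 ≠ 0 := by linarith
    field_simp
    ring
  have hmean : (∑ i, y i) / d = 1 := by rw [hsum, div_self hdpos.ne']
  have hspread : (∑ i, (y i - 1) ^ 2) / d ≤ ε := by
    rw [hvar, div_div, div_le_iff₀ (by nlinarith)]
    -- d ≤ ε d (d-1), i.e. 1 ≤ ε (d - 1) = ε (m+1)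
    have hm' : 1 / ((m : ℝ) + 1) < ε := hm
    have hdm : (d : ℝ) - 1 = (m : ℝ) + 1 := by
      simp only [hd]
      push_cast
      ring
    rw [one_div_lt (by positivity) hε] at hm'
    have : 1 / ε * (d : ℝ) ≤ ((m : ℝ) + 1) * (d : ℝ) := mul_le_mul_of_nonneg_right hm'.le hdpos.le
    calc (d : ℝ) = ε * (1 / ε * (d : ℝ)) := by field_simp
      _ ≤ ε * (((m : ℝ) + 1) * (d : ℝ)) := mul_le_mul_of_nonneg_left this hε.le
      _ = ε * (((d : ℝ) - 1) * (d : ℝ)) := by rw [hdm]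
  have hdark := h d y hd2 hmean hspread ⟨0, by omega⟩
  simp [y] at hdark


/-! ## §13 (gen 3, new) g-UNIFORM rungs do not give EVERY-GS order at the corner (exact degeneracy AT
`g = 0`), although — `Negative/CornerDanskin.lean`, Danskin by compactness — they do give SOME ordered
ground state of the pure torus (an "∃-ground-state summit") -/

/-- Toy kinetic part with an exact degeneracy at the corner: `A₀ = 0` (both levels are ground states at
`g = 0`). [folklore] -/
def toyA₀ : Matrix (Fin 2) (Fin 2) ℝ := 0

/-- `⟨v, (A₀ − gP) v⟩ = −40 g v₁²`. [folklore] -/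
theorem toy₀_form (g : ℝ) (v : Fin 2 → ℝ) :
    v ⬝ᵥ (toyA₀ - g • toyP) *ᵥ v = -(40 * g) * v 1 ^ 2 := by
  simp [toyA₀, toyP, Matrix.mulVec, dotProduct, Fin.sum_univ_two, Matrix.diagonal,
    Matrix.sub_apply]
  ring

/-- g-UNIFORM RUNGS in the toy: for EVERY seed `g > 0`, every toy ground state of `A₀ − gP` has
`⟨P⟩ = 40` (the ordered level `e₁` is the unique ground state as soon as `g > 0`). [folklore] -/
theorem toy₀_uniformRungs (g : ℝ) (hg : 0 < g) (v : Fin 2 → ℝ) (hv : IsToyGS (toyA₀ - g • toyP) v) :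
    (40 : ℝ) ≤ v ⬝ᵥ toyP *ᵥ v := by
  obtain ⟨hn, hmin⟩ := hv
  have h := hmin ![0, 1] (by simp [dotProduct, Fin.sum_univ_two])
  rw [toy₀_form, toy₀_form] at h
  rw [toy_norm] at hn
  rw [toy_formP]
  simp at h
  nlinarith

/-- … yet at the corner `g = 0` there is a DARK ground state (`e₀`, `⟨P⟩ = 0`) next to the ordered one
(`e₁`, `⟨P⟩ = 40`): the `∃`-GS conclusion holds, the EVERY-GS conclusion fails. [folklore] -/
theorem toy₀_corner :
    (∃ v : Fin 2 → ℝ, IsToyGS toyA₀ v ∧ v ⬝ᵥ toyP *ᵥ v = 0) ∧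
      (∃ v : Fin 2 → ℝ, IsToyGS toyA₀ v ∧ v ⬝ᵥ toyP *ᵥ v = 40) := by
  have hform : ∀ w : Fin 2 → ℝ, w ⬝ᵥ toyA₀ *ᵥ w = 0 := by
    intro w; simp [toyA₀]
  refine ⟨⟨![1, 0], ⟨by simp [dotProduct, Fin.sum_univ_two], fun w _ => ?_⟩, by rw [toy_formP]; simp⟩,
    ⟨![0, 1], ⟨by simp [dotProduct, Fin.sum_univ_two], fun w _ => ?_⟩, by rw [toy_formP]; simp⟩⟩ <;>
  · rw [hform, hform]

/-- **The uniform-rungs shape is FALSE for abstract seeded families.** It is NOT true that for every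
symmetric `A` and `P ≥ 0`, g-UNIFORM every-GS order on all seeds `g ∈ (0, 1/10]` (one constant for all
small seeds — the strongest hypothesis a `g > 0` engine can deliver, cf. `CornerPersistence` /
`TwSeededRung` with `∀K`) forces every-GS order at seed `0`: `A₀ = 0`, `P = diag(0,40)` has uniform
rungs `⟨P⟩ ≥ 40` for all `g > 0` and the dark ground state `e₀` at `g = 0` (exact level crossing AT the
corner). Compare `not_abstract_tipShape` (crossing inside `(0,1/20)`, rungs not uniform) and, on the
positive side, `existsGSOrder_pure_of_uniformRungs` (Danskin: uniform rungs DO give an ordered branch). [folklore] -/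
theorem not_abstract_uniformRungsShape :
    ¬ (∀ (A P : Matrix (Fin 2) (Fin 2) ℝ), P.PosSemidef →
        (∀ g : ℝ, 0 < g → g ≤ 1 / 10 → ∀ v, IsToyGS (A - g • P) v → 1 ≤ v ⬝ᵥ P *ᵥ v) →
          ∀ v, IsToyGS A v → 0 < v ⬝ᵥ P *ᵥ v) := by
  intro h
  obtain ⟨⟨v, hv, hP⟩, -⟩ := toy₀_corner
  have hr : ∀ g : ℝ, 0 < g → g ≤ 1 / 10 → ∀ w, IsToyGS (toyA₀ - g • toyP) w → 1 ≤ w ⬝ᵥ toyP *ᵥ w :=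
    fun g hg _ w hw => le_trans (by norm_num) (toy₀_uniformRungs g hg w hw)
  have := h toyA₀ toyP toyP_posSemidef hr v hv
  rw [hP] at this
  exact lt_irrefl _ this


/-! ## §14 (gen 3, new) DANSKIN AT THE CORNER by compactness (landed: `Negative/SeedContinuity.lean`,
`Negative/CornerDanskin.lean`): the suppression-cost formulation IS `OrderBound U δ 0`; g-uniform rungs
give an ordered ground-state BRANCH (an `∃`-GS summit), never every-GS -/

/-- The suppression-cost hypothesis of §7 (`orderBound_zero_of_suppressionCost`): eventually in even `L`
some repulsive d-wave pair term `+(η_L/L²)P_L` costs at least `c·η_L·L²` of sector energy. [folklore] -/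
def SuppressionCost (U δ : ℝ) : Prop :=
  ∃ c : ℝ, 0 < c ∧ ∃ L₀ : ℕ, ∀ (L : ℕ) [NeZero L], L₀ ≤ L → Even L →
    ∃ η : ℝ, 0 < η ∧ c * η * (L : ℝ) ^ 2 ≤
      sectorEnergy U (-η) L (halfN δ L) - sectorEnergy U 0 L (halfN δ L)

/-- g-UNIFORM rungs near the corner (the `CornerPersistence` / `TwSeededRung`-with-`∀K` shape): ONE
constant and ONE threshold for all seeds `g ∈ (0, g₁]`. [folklore] -/
def UniformRungs (U δ : ℝ) : Prop :=
  ∃ c : ℝ, 0 < c ∧ ∃ g₁ : ℝ, 0 < g₁ ∧ ∃ L₀ : ℕ, ∀ (L : ℕ) [NeZero L], L₀ ≤ L → Even L →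
    ∀ g ∈ Set.Ioc (0 : ℝ) g₁, ∀ ψ : Fock (Orb (FermionTorus 2 L)), star ψ ⬝ᵥ ψ = 1 →
      IsGroundStateInSector (seededH U g L) (pairNumber δ L) 0 ψ →
        c * (L : ℝ) ^ 4 ≤ (expect (pairIntensity L) ψ).re

/-- SOME-ground-state order of the pure torus, eventually in even `L` (the `∃`-GS weakening of
`OrderBound U δ 0`). [folklore] -/
def ExistsGSOrder (U δ : ℝ) : Prop :=
  ∃ c : ℝ, 0 < c ∧ ∃ L₀ : ℕ, ∀ (L : ℕ) [NeZero L], L₀ ≤ L → Even L →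
    ∃ ψ : Fock (Orb (FermionTorus 2 L)), star ψ ⬝ᵥ ψ = 1 ∧
      IsGroundStateInSector (hubbardTorus 2 L 1 U) (pairNumber δ L) 0 ψ ∧
        c * (L : ℝ) ^ 4 ≤ (expect (pairIntensity L) ψ).re

/-- **Danskin, penalty side (converse of §7)**: `OrderBound U δ 0 → SuppressionCost U δ` (constant
`c/2`; at each side the repulsive seed `η_L` is found by compactness: ground states of `H_L(U,−η)`,
`η ↓ 0`, accumulate at ground states of the pure torus — `Negative.exists_suppressionCost_of_forall_groundState`).
[folklore] -/
theorem suppressionCost_of_orderBound_zero {U δ : ℝ} (hδ : -1 ≤ δ) (h : OrderBound U δ 0) :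
    SuppressionCost U δ := by
  obtain ⟨c, hc, L₀, h⟩ := h
  refine ⟨c / 2, half_pos hc, L₀, fun L _ hL₀ hE => ?_⟩
  have hn : halfN δ L ≤ Fintype.card (FermionTorus 2 L) := by
    rw [Summit.HubbardSuperconductivity.NoGo.card_fermionTorus_two]
    exact Summit.HubbardSuperconductivity.NoGo.floor_pairNumber_le δ hδ L
  have hL : (0 : ℝ) < (L : ℝ) ^ 4 := by
    have := NeZero.pos L
    positivity
  have hB : c / 2 * (L : ℝ) ^ 4 < c * (L : ℝ) ^ 4 := by nlinarith
  obtain ⟨η, hη, hcost⟩ :=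
    Summit.HubbardSuperconductivity.TwTipContinuation.Negative.exists_suppressionCost_of_forall_groundState
      (U := U) hn hB (fun ψ hψ hgs => h L hL₀ hE ψ hψ hgs)
  refine ⟨η, hη, ?_⟩
  have hL2 : ((L : ℝ) ^ 2) ≠ 0 := by
    have := NeZero.pos L
    positivity
  calc c / 2 * η * (L : ℝ) ^ 2 = η / (L : ℝ) ^ 2 * (c / 2 * (L : ℝ) ^ 4) := by
        rw [eq_comm, div_mul_eq_mul_div, div_eq_iff hL2]
        ring
    _ ≤ _ := hcost

/-- **The corner on the penalty side in normal form**: `SuppressionCost U δ ⟺ OrderBound U δ 0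
(⟺ SummitAt U δ)`. Energy-inequality reformulations of the corner — in particular the isogap line's
sliver stub `E_L(U,−s₀/L²) − E_L(U,0) ≥ s₀(μ−ε)` — are the crux's conclusion itself at `(U,δ)`, not a
weakening: such a line relocates the difficulty, it does not divide it. [folklore] -/
theorem suppressionCost_iff_orderBound_zero {U δ : ℝ} (hδ : -1 ≤ δ) :
    SuppressionCost U δ ↔ OrderBound U δ 0 :=
  ⟨orderBound_zero_of_suppressionCost, suppressionCost_of_orderBound_zero hδ⟩

/-- **Danskin, attractive side**: g-uniform rungs give SOME ordered ground state of the pure torus,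
eventually in even `L` (ground states of `H_L(U,g)`, `g ↓ 0`, accumulate at ground states of `H_L(U,0)`
and carry their order along — `Negative.exists_groundState_order_of_uniformSeeds`). [folklore] -/
theorem existsGSOrder_of_uniformRungs {U δ : ℝ} (hδ : -1 ≤ δ) (h : UniformRungs U δ) :
    ExistsGSOrder U δ := by
  obtain ⟨c, hc, g₁, hg₁, L₀, h⟩ := h
  refine ⟨c, hc, L₀, fun L _ hL₀ hE => ?_⟩
  have hn : halfN δ L ≤ Fintype.card (FermionTorus 2 L) := by
    rw [Summit.HubbardSuperconductivity.NoGo.card_fermionTorus_two]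
    exact Summit.HubbardSuperconductivity.NoGo.floor_pairNumber_le δ hδ L
  obtain ⟨ψ, hψ, hgs, hB⟩ :=
    Summit.HubbardSuperconductivity.TwTipContinuation.Negative.exists_groundState_order_of_uniformSeeds
      (U := U) hn hg₁ (fun g hg0 hg1 ψ hψ hgs => h L hL₀ hE g ⟨hg0, hg1⟩ ψ hψ hgs)
  refine ⟨ψ, hψ, ?_, hB⟩
  simpa only [seededH_zero] using hgs

/-- Uniform rungs imply the rung at each fixed small seed (hence, by `orderBound_mono`, `OrderBound U δ g`
for every `g > 0`) — but NOT `OrderBound U δ 0`: abstractly the implication fails by an exact level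
crossing AT the corner (`not_abstract_uniformRungsShape`, §13; landed `Negative.not_abstractUniformRungsShape`). [folklore] -/
theorem orderBound_of_uniformRungs {U δ g : ℝ} (hg : 0 < g) (h : UniformRungs U δ) : OrderBound U δ g := by
  obtain ⟨c, hc, g₁, hg₁, L₀, h⟩ := h
  have key : OrderBound U δ (min g g₁) :=
    ⟨c, hc, L₀, fun L _ hL₀ hE ψ hψ hgs => h L hL₀ hE (min g g₁) ⟨lt_min hg hg₁, min_le_right _ _⟩ ψ hψ hgs⟩
  exact orderBound_mono (min_le_left _ _) key

/-- `OrderBound U δ 0 → ExistsGSOrder U δ` (every ⇒ some; ground states exist). [folklore] -/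
theorem existsGSOrder_of_orderBound_zero {U δ : ℝ} (hδ : -1 ≤ δ) (h : OrderBound U δ 0) :
    ExistsGSOrder U δ := by
  obtain ⟨c, hc, L₀, h⟩ := h
  refine ⟨c, hc, L₀, fun L _ hL₀ hE => ?_⟩
  have hn : halfN δ L ≤ Fintype.card (FermionTorus 2 L) := by
    rw [Summit.HubbardSuperconductivity.NoGo.card_fermionTorus_two]
    exact Summit.HubbardSuperconductivity.NoGo.floor_pairNumber_le δ hδ L
  obtain ⟨ψ, hψ, hgs⟩ := exists_unit_groundState U 0 L hn
  refine ⟨ψ, hψ, ?_, h L hL₀ hE ψ hψ hgs⟩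
  simpa only [seededH_zero] using hgs

/-- **WHERE EVERY LINE MUST SPEND ITS EFFORT (summary of §7, §13, §14).** At `(U,δ)` with `δ ≥ −1`:
`UniformRungs ⟹ ExistsGSOrder` (Danskin) and `OrderBound 0 ⟺ SuppressionCost ⟺ SummitAt` (Danskin +
chords), `OrderBound 0 ⟹ ExistsGSOrder`; abstractly `UniformRungs ⇏ OrderBound 0` (§13). So a proof of the
crux decomposes canonically into (a) an `∃`-GS / g-uniform statement reachable from the seeded family and
(b) a statement EXCLUDING a dark ground state of the pure torus next to the ordered branch at the SAME
`(U,δ,L)` — an exact-degeneracy / ground-space-homogeneity statement at `O(1)` total-energy resolution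
(the moments line's T2+T3, the isogap line's `groundSpaceHomogeneity`, `TwistGap`-type rigidity). Part
(b) is where no `g > 0` or `T > 0` hypothesis helps. [folklore] -/
theorem corner_summary {U δ : ℝ} (hδ : -1 ≤ δ) :
    (UniformRungs U δ → ExistsGSOrder U δ) ∧ (OrderBound U δ 0 ↔ SuppressionCost U δ) ∧
      (OrderBound U δ 0 ↔ SummitAt U δ) ∧ (OrderBound U δ 0 → ExistsGSOrder U δ) :=
  ⟨existsGSOrder_of_uniformRungs hδ, (suppressionCost_iff_orderBound_zero hδ).symm,
    (summitAt_iff_orderBound_zero hδ).symm, existsGSOrder_of_orderBound_zero hδ⟩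


/-! ## §15 (gen 3) TARGETS — line `isogap-submodular-transport` (PICKED 2026-08-16T01:22Z; skeleton
`Lines/isogap-submodular-transport.lean`, 4 stubs). Verdicts: `stub_danskinAttainment` PROVED (candidate
proof attached as item evidence `DanskinAttainmentProof.lean`, from landed `Negative/SeedContinuity.lean`);
`stub_edgeOrder`, `stub_isogapTransport`, `stub_groundSpaceHomogeneity` resist cheap attacks (no junk
instance: window, normalisation, `NeZero`, eventual-in-`L` all sound); the three unproved stubs WITHOUT
homogeneity reach exactly the `∃`-GS summit (`existsGSOrderWindow_of_transport_edge`, below) — the every-GS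
burden of the crux sits entirely in `stub_groundSpaceHomogeneity` (cf. §14 `corner_summary`). -/

/-- **Danskin attainment** (the picked line's `stub_danskinAttainment`, verbatim signature; PROVED — also
attached as item evidence `DanskinAttainmentProof.lean`; landed by the lead as `IsogapTransport.stub_danskinAttainment`): a
linear lower bound `B·s ≤ E_L(U,0) − E_L(U,s)` (`0 < s < s₁`) on the seed's gain forces every ground state at
each seed `s ∈ (0,s₁/2]` to carry `re⟨P_L⟩ ≥ B L²` (left chord), hence — Danskin's attractive side by
compactness, `Negative.exists_groundState_order_of_uniformSeeds` (landed) — SOME ground state of the pure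
torus with `re⟨P_L⟩ ≥ B L²`. [folklore] -/
theorem danskinAttainment :
    ∀ (L : ℕ) [NeZero L] (U : ℝ) (n : ℕ) (B s₁ : ℝ), n ≤ Fintype.card (FermionTorus 2 L) → 0 < s₁ →
      (∀ s ∈ Set.Ioo (0 : ℝ) s₁, B * s ≤
        (Matrix.minEnergyOn (hubbardTorus 2 L 1 U) (szSector (2 * n) 0))
          - (Matrix.minEnergyOn (hubbardTorus 2 L 1 U - ((s / (L : ℝ) ^ 2 : ℝ) : ℂ) • ((pairField dWaveFormFactor L)ᴴ * pairField dWaveFormFactor L)) (szSector (2 * n) 0))) →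
      ∃ ψ : Fock (Orb (FermionTorus 2 L)), star ψ ⬝ᵥ ψ = 1 ∧ IsGroundStateInSector (hubbardTorus 2 L 1 U) (2 * n) 0 ψ ∧
        B * (L : ℝ) ^ 2 ≤ (expect ((pairField dWaveFormFactor L)ᴴ * pairField dWaveFormFactor L) ψ).re := by
  intro L _ U n B s₁ hn hs₁ h
  have hL : (0 : ℝ) < (L : ℝ) ^ 2 := by
    have := NeZero.pos L
    positivity
  have hkey : ∀ g : ℝ, 0 < g → g ≤ s₁ / 2 → ∀ ψ : Fock (Orb (FermionTorus 2 L)), star ψ ⬝ᵥ ψ = 1 →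
      IsGroundStateInSector (seededH U g L) (2 * n) 0 ψ → B * (L : ℝ) ^ 2 ≤ (expect (pairIntensity L) ψ).re := by
    intro g hg0 hg1 ψ hψ hgs
    have hB := h g ⟨hg0, by linarith⟩
    have hl := leftChord_le_order (U := U) (g := g) (g' := 0) hg0 hψ hgs
    simp only [sectorEnergy, seededH_zero] at hl
    have hc : B * g ≤ (g - 0) / (L : ℝ) ^ 2 * (expect (pairIntensity L) ψ).re := hB.trans hl
    rw [sub_zero, div_mul_eq_mul_div, le_div_iff₀ hL] at hc
    have hc' : g * (B * (L : ℝ) ^ 2) ≤ g * (expect (pairIntensity L) ψ).re := by nlinarith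
    exact le_of_mul_le_mul_left hc' hg0
  obtain ⟨ψ, hψ, hgs, hB⟩ :=
    Summit.HubbardSuperconductivity.TwTipContinuation.Negative.exists_groundState_order_of_uniformSeeds
      (U := U) hn (half_pos hs₁) hkey
  refine ⟨ψ, hψ, ?_, hB⟩
  simpa only [seededH_zero] using hgs

/-- The lead's `stub_edgeOrder`, verbatim (every GS of the `U = 0` reduced d-wave BCS torus is ordered, for
every seed `c > 0` and every doping of the window). A BET (classical BCS, unproved as an every-GS canonical
statement); no cheap refutation: seniority/nodal-level degeneracies of the reduced model leave the active
paired part, hence `re⟨P_L⟩`, unchanged. [folklore] -/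
def StubEdgeOrder : Prop :=
  ∀ δ ∈ Set.Icc (1 / 10 : ℝ) (2 / 5), ∀ c : ℝ, 0 < c → ∃ μ : ℝ, 0 < μ ∧ ∃ L₀ : ℕ, ∀ (L : ℕ) [NeZero L], L₀ ≤ L → Even L →
    ∀ ψ : Fock (Orb (FermionTorus 2 L)), star ψ ⬝ᵥ ψ = 1 →
      IsGroundStateInSector (seededH 0 c L) (pairNumber δ L) 0 ψ → μ * (L : ℝ) ^ 4 ≤ (expect (pairIntensity L) ψ).re

/-- The lead's `stub_isogapTransport`, verbatim up to the §0 abbreviations (STRIP transport along isogap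
characteristics; the crux-sized stub). By Danskin at fixed `L` (`s ↓ 0`) it contains the max-GS order
comparison `M_pure(U,L) ≥ M_edge(aU²,L) − εL⁴`; the `L`-independent `s₁` adds thermodynamic-limit regularity.
Its cheapest falsifier is the sign of the Kohn–Luttinger B1g coefficient `a₂(δ)` at the chosen `δ` — positive
throughout the d_{x²−y²} region `0.6 < n < 1` (Literature in the header); choose `δ ∈ [0.1,0.3]`. [folklore] -/
def StubIsogapTransport : Prop :=
  ∃ δ ∈ Set.Icc (1 / 10 : ℝ) (2 / 5), ∃ U₁ a : ℝ, 0 < U₁ ∧ 0 < a ∧ ∀ U ∈ Set.Ioc (0 : ℝ) U₁, ∃ s₁ : ℝ, 0 < s₁ ∧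
    ∀ ε : ℝ, 0 < ε → ∃ L₀ : ℕ, ∀ (L : ℕ) [NeZero L], L₀ ≤ L → Even L → ∀ s ∈ Set.Ioc (0 : ℝ) s₁,
      sectorEnergy 0 (a * U ^ 2) L (halfN δ L) - sectorEnergy 0 (a * U ^ 2 + s) L (halfN δ L) - ε * s * (L : ℝ) ^ 2 ≤
        (hubbardTorus 2 L 1 U).minEnergyOn (szSector (pairNumber δ L) 0) - sectorEnergy U s L (halfN δ L)

/-- READBACK: `StubIsogapTransport` is the skeleton's literal statement (`Iff.rfl` after unfolding §0). [folklore] -/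
theorem stubIsogapTransport_iff :
    StubIsogapTransport ↔
      ∃ δ ∈ Set.Icc (1 / 10 : ℝ) (2 / 5), ∃ U₁ a : ℝ, 0 < U₁ ∧ 0 < a ∧ ∀ U ∈ Set.Ioc (0 : ℝ) U₁, ∃ s₁ : ℝ, 0 < s₁ ∧
      ∀ ε : ℝ, 0 < ε → ∃ L₀ : ℕ, ∀ (L : ℕ) [NeZero L], L₀ ≤ L → Even L → ∀ s ∈ Set.Ioc (0 : ℝ) s₁,
        (Matrix.minEnergyOn (hubbardTorus 2 L 1 0 - ((a * U ^ 2 / (L : ℝ) ^ 2 : ℝ) : ℂ) • ((pairField dWaveFormFactor L)ᴴ * pairField dWaveFormFactor L)) (szSector (2 * ⌊(1 - δ) * (L : ℝ) ^ 2 / 2⌋₊) 0))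
          - (Matrix.minEnergyOn (hubbardTorus 2 L 1 0 - (((a * U ^ 2 + s) / (L : ℝ) ^ 2 : ℝ) : ℂ) • ((pairField dWaveFormFactor L)ᴴ * pairField dWaveFormFactor L)) (szSector (2 * ⌊(1 - δ) * (L : ℝ) ^ 2 / 2⌋₊) 0))
          - ε * s * (L : ℝ) ^ 2 ≤
        (Matrix.minEnergyOn (hubbardTorus 2 L 1 U) (szSector (2 * ⌊(1 - δ) * (L : ℝ) ^ 2 / 2⌋₊) 0))
          - (Matrix.minEnergyOn (hubbardTorus 2 L 1 U - ((s / (L : ℝ) ^ 2 : ℝ) : ℂ) • ((pairField dWaveFormFactor L)ᴴ * pairField dWaveFormFactor L)) (szSector (2 * ⌊(1 - δ) * (L : ℝ) ^ 2 / 2⌋₊) 0)) :=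
  Iff.rfl

/-- The `∃`-GS summit on a window: at one doping of `[1/10,2/5]`, for all small `U`, SOME ordered ground state
of the pure torus eventually in even `L`. [folklore] -/
def ExistsGSOrderWindow : Prop :=
  ∃ U₁ : ℝ, 0 < U₁ ∧ ∃ δ ∈ Set.Icc (1 / 10 : ℝ) (2 / 5), ∀ U ∈ Set.Ioc (0 : ℝ) U₁, ExistsGSOrder U δ

/-- **What the line proves WITHOUT its homogeneity stub: exactly the `∃`-GS summit.** `StubIsogapTransport ∧
StubEdgeOrder → ExistsGSOrderWindow` (edge order `μ` at seed `aU²` ⇒ right chord: edge gain `≥ μ s L²` ⇒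
transport with `ε = μ/4`: pure gain `≥ (3μ/4) s L²` on `(0,s₁)` ⇒ Danskin attainment (landed, by compactness):
a ground state of the pure torus with `re⟨P_L⟩ ≥ (3μ/4) L⁴`). The converse direction of §13/§14 says this is
also ALL that any `g > 0` hypothesis can give: `stub_groundSpaceHomogeneity` carries the entire every-GS content
of the crux. [folklore] -/
theorem existsGSOrderWindow_of_transport_edge (hT : StubIsogapTransport) (hE : StubEdgeOrder) :
    ExistsGSOrderWindow := by
  obtain ⟨δ, hδ, U₁, a, hU₁, ha, hT⟩ := hT
  refine ⟨U₁, hU₁, δ, hδ, fun U hU => ?_⟩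
  have hδ' : (-1 : ℝ) ≤ δ := by linarith [hδ.1]
  have haU : 0 < a * U ^ 2 := by
    have := hU.1
    positivity
  obtain ⟨μ, hμ, L₁, hEdge⟩ := hE δ hδ (a * U ^ 2) haU
  obtain ⟨s₁, hs₁, hT'⟩ := hT U hU
  obtain ⟨L₂, hT''⟩ := hT' (μ / 4) (by positivity)
  refine ⟨3 * μ / 4, by positivity, max L₁ L₂, fun L _ hL hEv => ?_⟩
  have hL₁ : L₁ ≤ L := le_trans (le_max_left _ _) hL
  have hL₂ : L₂ ≤ L := le_trans (le_max_right _ _) hL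
  have hn : halfN δ L ≤ Fintype.card (FermionTorus 2 L) := by
    rw [Summit.HubbardSuperconductivity.NoGo.card_fermionTorus_two]
    exact Summit.HubbardSuperconductivity.NoGo.floor_pairNumber_le δ hδ' L
  have hLpos : (0 : ℝ) < (L : ℝ) ^ 2 := by
    have := NeZero.pos L
    positivity
  -- pure gain ≥ (3μ/4) s L² for s ∈ (0, s₁)
  have hgain : ∀ s ∈ Set.Ioo (0 : ℝ) s₁, (3 * μ / 4 * (L : ℝ) ^ 2) * s ≤
      (hubbardTorus 2 L 1 U).minEnergyOn (szSector (2 * halfN δ L) 0) - sectorEnergy U s L (halfN δ L) := by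
    intro s hs
    -- edge gain ≥ μ s L² : right chord at a normalised GS of the edge at seed aU²
    obtain ⟨φ, hφ, hφgs⟩ := exists_unit_groundState 0 (a * U ^ 2) L hn
    have hr := order_le_rightChord (U := 0) (g := a * U ^ 2) (g'' := a * U ^ 2 + s) (by linarith [hs.1]) hφ hφgs
    have hb := hEdge L hL₁ hEv φ hφ hφgs
    have key : (a * U ^ 2 + s - a * U ^ 2) / (L : ℝ) ^ 2 * (μ * (L : ℝ) ^ 4) ≤
        (a * U ^ 2 + s - a * U ^ 2) / (L : ℝ) ^ 2 * (expect (pairIntensity L) φ).re :=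
      mul_le_mul_of_nonneg_left hb (div_nonneg (by linarith [hs.1]) hLpos.le)
    have hid : (a * U ^ 2 + s - a * U ^ 2) / (L : ℝ) ^ 2 * (μ * (L : ℝ) ^ 4) = μ * s * (L : ℝ) ^ 2 := by
      field_simp
      ring
    have hB := hT'' L hL₂ hEv s ⟨hs.1, hs.2.le⟩
    have : (3 * μ / 4 * (L : ℝ) ^ 2) * s = μ * s * (L : ℝ) ^ 2 - μ / 4 * s * (L : ℝ) ^ 2 := by ring
    simp only [sectorEnergy, seededH, pairIntensity, pairNumber] at hr hB ⊢
    linarith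
  obtain ⟨ψ₀, hψ₀, hgs₀, hP₀⟩ :=
    danskinAttainment L U _
      (3 * μ / 4 * (L : ℝ) ^ 2) s₁ hn hs₁ hgain
  refine ⟨ψ₀, hψ₀, hgs₀, ?_⟩
  have : 3 * μ / 4 * (L : ℝ) ^ 2 * (L : ℝ) ^ 2 = 3 * μ / 4 * (L : ℝ) ^ 4 := by ring
  linarith

end Summit.HubbardSuperconductivity.HubbardSuperconductivity.Cruxes.TwTipContinuation.Disproof
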